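import Literature.NumberTheory.ConnesConsani.ScalingSiteH0Levels
import HarnessLib

/-!
# Connes–Consani, *Geometry of the scaling site* (2017), §5.3: the theta functions `Θ_{h,μ}` of the
# periodic orbit `C_p`, functions with prescribed divisor (Prop. 5.11) and the canonical
# decomposition of every `f ∈ 𝒦(C_p)` (Theorem 5.12 = third Theorem of §1) — PROVED

Topic `Literature/NumberTheory/ConnesConsani`. Source: A. Connes, C. Consani, *Geometry of the
scaling site*, Selecta Math. (N.S.) 23 (2017) 1803–1850 = arXiv:1603.03191
[bib `ConnesConsani2017ScalingSite`], §5.3 "Theta functions" (numbering of the Selecta paper).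
This file continues `ScalingSitePeriodicOrbit` (objects `IsCpRational` = `𝒦(C_p)`, `cpOrder`,
`CpDivisor`, the basic theta function `cpTheta` = `θ`, Lemma 5.10 PROVED there) and
`ScalingSiteH0Levels` (one-sided slopes, piece data based at `1`).

## The statements, verbatim

* (after Lemma 5.10) "We define, for `h ∈ H_p`, `h > 0` and `μ ∈ ℝ₊*`, the function
  `Θ_{h,μ}(λ) := μ θ(μ⁻¹hλ)`. It is a convex continuous, piecewise affine function with slopes in
  `H_p` and fulfills the equation `Θ_{h,μ}(pλ) = Θ_{h,μ}(λ) + hλ - μ` […] It follows that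
  `Θ_{ph,μ}(λ) = Θ_{h,μ}(λ) + hλ - μ`. To a pair of labels `(h, μ)` we associate the divisor which is
  everywhere zero except on the subgroup `H = μh⁻¹H_p` […] where it takes the value `μ ∈ H`. We let
  `δ(h, μ) := (μh⁻¹H_p, μ)`. Note that by construction one has `δ(ph, μ) = δ(h, μ)`".
* **Proposition 5.11.** "Let `D = D₊ - D₋ ∈ Div(C_p)` be a divisor (`D± ∈ Div⁺`) and
  `(h_i, μ_i) ∈ H_p⁺ × ℝ₊*`, `(h'_j, μ'_j) ∈ H_p⁺ × ℝ₊*` such that `D₊ = Σ δ(h_i, μ_i)` and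
  `D₋ = Σ δ(h'_j, μ'_j)`. Then, if `deg(D) = 0` and `h ∈ H_p` fulfills `(p-1)h = Σ h_i - Σ h'_j`, the
  following function `f(λ) := Σ_i Θ_{h_i,μ_i}(λ) - Σ_j Θ_{h'_j,μ'_j}(λ) - hλ` is continuous,
  piecewise affine with slopes in `H_p`, fulfills `f(pλ) = f(λ)` `∀λ ∈ ℝ₊*` and one has:
  `div(f) = D`."
* **Theorem 5.12.** "Let `f ∈ 𝒦(C_p)`. Then `f` admits the following canonical decomposition
  `f(λ) = Σ_i Θ_{h_i,μ_i}(λ) - Σ_j Θ_{h'_j,μ'_j}(λ) - hλ + c` where `c ∈ ℝ`,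
  `(p-1)h = Σ h_i - Σ h'_j` and `h_i ≤ μ_i < ph_i`, `h'_j ≤ μ'_j < ph'_j`." (Proof: "Let `D = (f)` be
  the principal divisor of `f`, and `D = D₊ - D₋` […] Since `δ(ph, μ) = δ(h, μ)` we can choose the
  `h_i` and `h'_j` in such a way that `μh⁻¹ ∈ [1, p)` for all of them […] Proposition 5.11 then shows
  that the function […] belongs to `𝒦(C_p)` and has the same divisor as `f` thus it differs from
  `f` by a constant `c ∈ ℝ`.")

## What is proved here (all statements are theorems; no named facts)

* `cpThetaHM p h μ` = `Θ_{h,μ}`; the two functional equations (`cpThetaHM_mul_p`,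
  `cpThetaHM_pmul`); on the fundamental domain a normalised theta function (`h ≤ μ < ph`) is the
  single hinge `Θ_{h,μ}(λ) = 0 ∨ (μ - hλ)` for `λ ∈ [1, p]` (`cpThetaHM_eq_max`), because
  `θ(λ) = 0 ∨ (1 - λ)` on `[1/p, p]` (`cpTheta_eq_max`).
* `𝒦(C_p)` is stable under `+`, `-` (`IsCpRational.add/neg/sub`, "the semifield `𝒦(C_p)`",
  Prop. 5.2 (i)); `(f + g) = (f) + (g)` (Prop. 5.4 (iv), `IsCpRational.cpOrder_add`); a rational
  function with zero divisor is constant and two rational functions with the same divisor differ by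
  a constant (`IsCpRational.exists_eq_const_of_cpOrder_eq_zero`, `…_of_cpOrder_eq`).
* **Prop. 5.11** for labels normalised as in Theorem 5.12 (`μ_i h_i⁻¹ ∈ [1, p)`), in the weighted
  form `F = Σ_i w_i Θ_{h_i,μ_i} - hλ`, `w_i ∈ ℤ` (the printed `D₊ - D₋` is `w_i = ±1`):
  `F ∈ 𝒦(C_p)` and `(F) = Σ_i w_i δ(h_i, μ_i)` (`thetaComb_isCpRational`, `cpOrder_thetaComb`), and
  the printed two-family form `ConnesConsani2017_prop_5_11` (normalised labels) and, for ARBITRARY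
  labels in `H_p⁺ × ℝ₊*` as printed, `ConnesConsani2017_prop_5_11_general` (reduction to normalised
  labels by `Θ_{ph,μ} = Θ_{h,μ} + hλ - μ`, `δ(ph,μ) = δ(h,μ)` iterated — `normSlope`,
  `cpThetaHM_eq_normSlope`, `thetaDelta_normSlope` — exactly as in the printed proof of Theorem 5.12).
* **Theorem 5.12** with the CANONICAL data read off the divisor of `f`: support points
  `c ∈ [1, p)` of `(f)`, labels `h_c = |ord_c f|/c`, `μ_c = |ord_c f|`, `h = (Σ_c ord_c f / c)/(p-1)`
  (`ConnesConsani2017_thm_5_12`), and the printed existential form (`ConnesConsani2017_thm_5_12'`).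

Design: as in `ScalingSitePeriodicOrbit`, points of `C_p` are `λ > 0` modulo `p^ℤ` with
representatives in `[1, p)`; `δ(h, μ)` is the function `λ ↦ μ` on the class of `μ/h`, `0` elsewhere
(`thetaDelta`; it is the point divisor `CpDivisor.single p _ (μ/h) μ`, `thetaDelta_eq_single`).
-/

noncomputable section

open Set Filter
open scoped Topology

namespace Literature.NumberTheory.ConnesConsani

/-! ## §5.3: the theta functions `Θ_{h,μ}` -/

/-- On `[1/p, p]` the basic theta function is the single hinge `θ(λ) = 0 ∨ (1 - λ)`: `θ = 0` on
`[1, p]` (proof of Lemma 5.10 (iii)) and `θ(λ) = θ(pλ) - λ + 1 = 1 - λ` on `[1/p, 1]` by the functional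
equation of Lemma 5.10 (ii). [cite: ConnesConsani2017ScalingSite, Lemma 5.10 (ii) and proof of (iii)] -/
theorem cpTheta_eq_max {p : ℕ} (hp : 1 < p) {y : ℝ} (h1 : 1 / (p : ℝ) ≤ y) (h2 : y ≤ p) :
    cpTheta p y = max 0 (1 - y) := by
  have hpR : (0 : ℝ) < p := by exact_mod_cast (zero_lt_one.trans hp)
  have hy : 0 < y := lt_of_lt_of_le (by positivity) h1
  rcases le_or_gt 1 y with hy1 | hy1
  · rw [cpTheta_eq_zero_of_mem_Icc hp hy1 h2, max_eq_left (by linarith)]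
  · have hpy1 : 1 ≤ (p : ℝ) * y := by
      rw [div_le_iff₀ hpR] at h1; linarith
    have hpy2 : (p : ℝ) * y ≤ p := by nlinarith
    have h := cpTheta_mul hp hy
    rw [cpTheta_eq_zero_of_mem_Icc hp hpy1 hpy2] at h
    rw [max_eq_right (by linarith)]
    linarith

/-- **The theta function with labels `(h, μ)`**: "`Θ_{h,μ}(λ) := μ θ(μ⁻¹hλ)`" for `h ∈ H_p`,
`h > 0`, `μ ∈ ℝ₊*`. [cite: ConnesConsani2017ScalingSite, §5.3 (definition after Lemma 5.10)] -/
def cpThetaHM (p : ℕ) (h μ : ℝ) (x : ℝ) : ℝ :=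
  μ * cpTheta p (h * x / μ)

/-- "`Θ_{h,μ}(pλ) = Θ_{h,μ}(λ) + hλ - μ`" (eq. (38) of the source, from Lemma 5.10 (ii)).
[cite: ConnesConsani2017ScalingSite, §5.3 eq. after the definition of Θ_{h,μ}] -/
theorem cpThetaHM_mul_p {p : ℕ} (hp : 1 < p) {h μ x : ℝ} (hh : 0 < h) (hμ : 0 < μ) (hx : 0 < x) :
    cpThetaHM p h μ (p * x) = cpThetaHM p h μ x + h * x - μ := by
  unfold cpThetaHM
  have e : h * (p * x) / μ = p * (h * x / μ) := by ring
  rw [e, cpTheta_mul hp (by positivity), mul_sub, mul_add, mul_div_cancel₀ _ hμ.ne']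
  ring

/-- "It follows that `Θ_{ph,μ}(λ) = Θ_{h,μ}(λ) + hλ - μ`". [cite: ConnesConsani2017ScalingSite, §5.3 (second displayed equation after the definition of Θ_{h,μ})] -/
theorem cpThetaHM_pmul {p : ℕ} (hp : 1 < p) {h μ x : ℝ} (hh : 0 < h) (hμ : 0 < μ) (hx : 0 < x) :
    cpThetaHM p (p * h) μ x = cpThetaHM p h μ x + h * x - μ := by
  have : cpThetaHM p (p * h) μ x = cpThetaHM p h μ (p * x) := by
    unfold cpThetaHM; ring_nf
  rw [this, cpThetaHM_mul_p hp hh hμ hx]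

/-- **A normalised theta function on the fundamental domain is a single hinge**: if
`h ≤ μ < ph` (i.e. `μh⁻¹ ∈ [1, p)`, the normalisation of Theorem 5.12) then
`Θ_{h,μ}(λ) = 0 ∨ (μ - hλ)` for `λ ∈ [1, p]`. [cite: ConnesConsani2017ScalingSite, Thm. 5.12 (proof: "μh⁻¹ ∈ [1,p)") with Lemma 5.10] -/
theorem cpThetaHM_eq_max {p : ℕ} (hp : 1 < p) {h μ x : ℝ} (hh : 0 < h) (h1 : h ≤ μ)
    (h2 : μ < p * h) (hx1 : 1 ≤ x) (hx2 : x ≤ p) :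
    cpThetaHM p h μ x = max 0 (μ - h * x) := by
  have hpR : (0 : ℝ) < p := by exact_mod_cast (zero_lt_one.trans hp)
  have hμ : 0 < μ := hh.trans_le h1
  have hy1 : 1 / (p : ℝ) ≤ h * x / μ := by
    rw [div_le_div_iff₀ hpR hμ]
    nlinarith
  have hy2 : h * x / μ ≤ p := by
    rw [div_le_iff₀ hμ]
    nlinarith
  unfold cpThetaHM
  rw [cpTheta_eq_max hp hy1 hy2, mul_max_of_nonneg _ _ hμ.le, mul_zero, mul_sub, mul_one,
    mul_div_cancel₀ _ hμ.ne']

open Classical in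
/-- **The divisor `δ(h, μ) := (μh⁻¹H_p, μ)`** as a function of `λ > 0`: the value `μ` on the class of
`μ/h` modulo `p^ℤ`, `0` elsewhere. [cite: ConnesConsani2017ScalingSite, §5.3 (definition of δ(h,μ))] -/
def thetaDelta (p : ℕ) (h μ : ℝ) (x : ℝ) : ℝ :=
  if InClass p (μ / h) x then μ else 0

/-- Unfolding `δ(h, μ)` (with any decidability instance). [cite: ConnesConsani2017ScalingSite, §5.3 (definition of δ(h,μ))] -/
theorem thetaDelta_apply {p : ℕ} (h μ x : ℝ) [Decidable (InClass p (μ / h) x)] :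
    thetaDelta p h μ x = if InClass p (μ / h) x then μ else 0 := by
  unfold thetaDelta
  congr

/-- `δ(h, μ)` is the point divisor `P = ((μ/h)H_p, μ)` of `ScalingSitePeriodicOrbit`
(`CpDivisor.single`). [cite: ConnesConsani2017ScalingSite, §5.3 (definition of δ(h,μ))] -/
theorem thetaDelta_eq_single {p : ℕ} (hp : 1 < p) {h μ : ℝ} (hh : 0 < h) (hμ : 0 < μ)
    (hhp : IsPFraction p h) (x : ℝ) :
    thetaDelta p h μ x =
      (CpDivisor.single p hp (μ / h) μ (div_pos hμ hh) (by rwa [div_div_cancel₀ hμ.ne'])).toFun x := by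
  classical
  rw [CpDivisor.single_apply, thetaDelta_apply]

/-- "`δ(ph, μ) = δ(h, μ)`" (the class of `μ/(ph)` is that of `μ/h`).
[cite: ConnesConsani2017ScalingSite, §5.3 ("by construction one has δ(ph,μ) = δ(h,μ)")] -/
theorem thetaDelta_pmul {p : ℕ} (hp : 1 < p) (h μ x : ℝ) :
    thetaDelta p (p * h) μ x = thetaDelta p h μ x := by
  have hp0 : (p : ℝ) ≠ 0 := by exact_mod_cast (zero_lt_one.trans hp).ne'
  have key : InClass p (μ / (p * h)) x ↔ InClass p (μ / h) x := by
    constructor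
    · rintro ⟨k, hk⟩
      refine ⟨k - 1, ?_⟩
      rw [hk, zpow_sub_one₀ hp0]
      field_simp
    · rintro ⟨k, hk⟩
      refine ⟨k + 1, ?_⟩
      rw [hk, zpow_add_one₀ hp0]
      field_simp
  classical
  rw [thetaDelta_apply, thetaDelta_apply]
  by_cases hc : InClass p (μ / h) x
  · rw [if_pos hc, if_pos (key.2 hc)]
  · rw [if_neg hc, if_neg (fun h' => hc (key.1 h'))]

/-- `δ(h, μ)` is a class function: `δ(h,μ)(pλ) = δ(h,μ)(λ)`. [cite: ConnesConsani2017ScalingSite, §5.3 (definition of δ(h,μ))] -/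
theorem thetaDelta_mul_p {p : ℕ} (hp : 1 < p) (h μ x : ℝ) :
    thetaDelta p h μ (p * x) = thetaDelta p h μ x := by
  classical
  rw [thetaDelta_apply, thetaDelta_apply]
  by_cases hc : InClass p (μ / h) x
  · rw [if_pos hc, if_pos ((inClass_mul_p_iff (zero_lt_one.trans hp)).2 hc)]
  · rw [if_neg hc, if_neg (fun h' => hc ((inClass_mul_p_iff (zero_lt_one.trans hp)).1 h'))]

/-- In the fundamental domain the class of `c ∈ [1, p)` meets `[1, p)` only at `c`.
[cite: ConnesConsani2017ScalingSite, Lemma 5.1 (i)] -/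
theorem inClass_iff_eq_of_mem {p : ℕ} (hp : 1 < p) {c x : ℝ} (hc1 : 1 ≤ c) (hc2 : c < p)
    (hx1 : 1 ≤ x) (hx2 : x < p) : InClass p c x ↔ x = c := by
  constructor
  · rintro ⟨k, hk⟩
    have h := zpow_mul_eq_zpow_mul_iff hp one_pos (k := 0) (k' := k) hx1 (by simpa using hx2) hc1
      (by simpa using hc2) (by simpa using hk)
    exact h.2
  · rintro rfl
    exact ⟨0, by simp⟩

/-- On the fundamental domain, `δ(h, μ)(λ) = μ` iff `λ = μ/h` (normalised label `μ/h ∈ [1, p)`).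
[cite: ConnesConsani2017ScalingSite, §5.3 (definition of δ(h,μ))] -/
theorem thetaDelta_of_mem {p : ℕ} (hp : 1 < p) {h μ x : ℝ} (hc1 : 1 ≤ μ / h) (hc2 : μ / h < p)
    (hx1 : 1 ≤ x) (hx2 : x < p) :
    thetaDelta p h μ x = if x = μ / h then μ else 0 := by
  classical
  rw [thetaDelta_apply]
  by_cases hc : InClass p (μ / h) x
  · rw [if_pos hc, if_pos ((inClass_iff_eq_of_mem hp hc1 hc2 hx1 hx2).1 hc)]
  · rw [if_neg hc, if_neg (fun h' => hc ((inClass_iff_eq_of_mem hp hc1 hc2 hx1 hx2).2 h'))]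


/-! ## `𝒦(C_p)` is a group under `+`; additivity of the order; functions with zero divisor

"The sheaf `𝒦_p` has global sections and they form the semifield `𝒦(C_p)`" (before Prop. 5.4;
operations `(∨, +)`, Prop. 5.2 (i)); "(f) := Σ_H (H, ord_H(f)) determines a group homomorphism
`𝒦^×(C_p) → Div(C_p)`" (Prop. 5.4 (iv)); two elements of `𝒦(C_p)` with the same divisor "differ
by a constant" (proof of Theorem 5.12). -/

section Group

variable {p : ℕ}

/-- `𝒦(C_p)` is stable under negation (slopes `-h_j ∈ H_p`). [cite: ConnesConsani2017ScalingSite, Prop. 5.2 (i) and Def. 5.3 ("the semifield 𝒦(C_p)")] -/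
theorem IsCpRational.neg {f : ℝ → ℝ} (hf : IsCpRational p f) : IsCpRational p (fun x => -f x) := by
  obtain ⟨hper, n, lam, h, h0, hmono, hlast, hmem, hpiece⟩ := hf
  refine ⟨fun x hx => ?_, n, lam, fun j => -h j, h0, hmono, hlast,
    fun j => (hmem j).neg, ?_⟩
  · show -f (p * x) = -f x
    rw [hper x hx]
  · intro j x hx1 hx2
    show -f x = -f (lam j.castSucc) + (-h j) * (x - lam j.castSucc)
    rw [hpiece j x hx1 hx2]
    ring

/-- **`𝒦(C_p)` is stable under addition** ("they form the semifield `𝒦(C_p)`"): piece data of `f`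
based at `1` refining those of `g` are piece data for `f + g`, with slopes `h_j + h'_{j'} ∈ H_p`.
[cite: ConnesConsani2017ScalingSite, Prop. 5.2 (i) and Def. 5.3 ("the semifield 𝒦(C_p)")] -/
theorem IsCpRational.add (hp : 1 < p) {f g : ℝ → ℝ} (hf : IsCpRational p f)
    (hg : IsCpRational p g) : IsCpRational p (fun x => f x + g x) := by
  classical
  have hp0 : 0 < p := zero_lt_one.trans hp
  obtain ⟨Tg, hTg, Pg, -, hPgl, hPgn, -⟩ := hg.exists_cpPieces_base_one hp ∅ (by simp)
  obtain ⟨T, hT, Pf, hsub, hPfl, hPfn, -⟩ := hf.exists_cpPieces_base_one hp Tg hTg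
  have hper : ∀ x, 0 < x → f (p * x) + g (p * x) = f x + g x := fun x hx => by
    rw [hf.1 x hx, hg.1 x hx]
  -- `g` is affine on every piece of the finer partition `T ⊇ Tg`
  have key : ∀ j, j ≤ T.card → ∀ x, bpts p T j ≤ x → x ≤ bpts p T (j + 1) →
      g x = g (bpts p T j) +
        derivWithin g (Ioi (bpts p T j)) (bpts p T j) * (x - bpts p T j) := by
    intro j hj x hx1 hx2
    have htj1 : 1 ≤ bpts p T j := one_le_bpts hp hT j
    have htjp : bpts p T j < p := bpts_lt_p hp hT hj
    obtain ⟨j', hj', h1, h2⟩ := exists_bpts_piece_right (T := Tg) htj1 htjp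
    have h3 : bpts p T (j + 1) ≤ bpts p Tg (j' + 1) := by
      by_contra hcon
      push Not at hcon
      have hmem : bpts p Tg (j' + 1) ∈ T ∨ bpts p Tg (j' + 1) = 1 ∨
          bpts p Tg (j' + 1) = (p : ℝ) := by
        rcases Nat.lt_or_ge j' Tg.card with h | h
        · exact Or.inl (hsub (bpts_mem (by omega) (by omega)))
        · exact Or.inr (Or.inr (bpts_of_card_lt (by omega)))
      exact not_mem_Ioo_bpts hp hT hmem hj ⟨h2, hcon⟩
    have e1 := Pg.piece j' (by omega) x (by rw [hPgl]; exact h1.trans hx1)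
      (by rw [hPgl]; exact hx2.trans h3)
    have e2 := Pg.piece j' (by omega) (bpts p T j) (by rw [hPgl]; exact h1)
      (by rw [hPgl]; exact h2.le)
    have e3 : derivWithin g (Ioi (bpts p T j)) (bpts p T j) = Pg.h j' :=
      Pg.derivWithin_Ioi_eq hPgl hPgn hj' h1 h2
    rw [e1, e2, e3, hPgl]
    ring
  set s : ℕ → ℝ := fun j => Pf.h j + derivWithin g (Ioi (bpts p T j)) (bpts p T j) with hs
  refine (CpPieces.ofFinset hp T hT (F := fun x => f x + g x) (g := fun x => f x + g x)
    (fun x hx => ?_) ?_ s (fun j hj => ?_) ?_).isCpRational hper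
  · show f x + g x = f (fundRed p 1 x) + g (fundRed p 1 x)
    rw [← hf.apply_eq_apply_fundRed hp one_pos hx, ← hg.apply_eq_apply_fundRed hp one_pos hx]
  · show f p + g p = f 1 + g 1
    have := hper 1 one_pos
    rwa [mul_one] at this
  · exact (Pf.h_mem j (by omega)).add hp0.ne'
      (hg.hasDerivWithinAt_Ioi hp (zero_lt_one.trans_le (one_le_bpts hp hT j))).2
  · intro j hj x hx1 hx2
    show f x + g x = (f (bpts p T j) + g (bpts p T j)) + s j * (x - bpts p T j)
    have e1 := Pf.piece j (by omega) x (by rw [hPfl]; exact hx1) (by rw [hPfl]; exact hx2)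
    rw [hPfl] at e1
    rw [e1, key j hj x hx1 hx2, hs]
    ring

/-- `𝒦(C_p)` is stable under subtraction. [cite: ConnesConsani2017ScalingSite, Prop. 5.2 (i) and Def. 5.3 ("the semifield 𝒦(C_p)")] -/
theorem IsCpRational.sub (hp : 1 < p) {f g : ℝ → ℝ} (hf : IsCpRational p f)
    (hg : IsCpRational p g) : IsCpRational p (fun x => f x - g x) := by
  have e : (fun x => f x - g x) = (fun x => f x + (fun y => -g y) x) := by
    funext x
    simp only [sub_eq_add_neg]
  rw [e]
  exact hf.add hp hg.neg

/-- **Additivity of the order** (Prop. 5.4 (iv), via Prop. 4.7 "`Ord(f + g) = Ord(f) + Ord(g)`") for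
functions with one-sided derivatives at `x`. [cite: ConnesConsani2017ScalingSite, Prop. 5.4 (iv) (with Prop. 4.7)] -/
theorem cpOrder_add_of_hasDerivWithinAt {f g : ℝ → ℝ} {x a b c d : ℝ}
    (hfR : HasDerivWithinAt f a (Ioi x) x) (hfL : HasDerivWithinAt f b (Iio x) x)
    (hgR : HasDerivWithinAt g c (Ioi x) x) (hgL : HasDerivWithinAt g d (Iio x) x) :
    cpOrder (fun y => f y + g y) x = cpOrder f x + cpOrder g x := by
  have hR : HasDerivWithinAt (fun y => f y + g y) (a + c) (Ioi x) x := hfR.add hgR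
  have hL : HasDerivWithinAt (fun y => f y + g y) (b + d) (Iio x) x := hfL.add hgL
  unfold cpOrder
  rw [hR.derivWithin (uniqueDiffWithinAt_Ioi x), hL.derivWithin (uniqueDiffWithinAt_Iio x),
    hfR.derivWithin (uniqueDiffWithinAt_Ioi x), hfL.derivWithin (uniqueDiffWithinAt_Iio x),
    hgR.derivWithin (uniqueDiffWithinAt_Ioi x), hgL.derivWithin (uniqueDiffWithinAt_Iio x)]
  ring

/-- The order of `-f` for a function with one-sided derivatives at `x`.
[cite: ConnesConsani2017ScalingSite, Prop. 5.4 (iv) (with Prop. 4.7)] -/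
theorem cpOrder_neg_of_hasDerivWithinAt {f : ℝ → ℝ} {x a b : ℝ}
    (hfR : HasDerivWithinAt f a (Ioi x) x) (hfL : HasDerivWithinAt f b (Iio x) x) :
    cpOrder (fun y => -f y) x = -cpOrder f x := by
  have hR : HasDerivWithinAt (fun y => -f y) (-a) (Ioi x) x := hfR.neg
  have hL : HasDerivWithinAt (fun y => -f y) (-b) (Iio x) x := hfL.neg
  unfold cpOrder
  rw [hR.derivWithin (uniqueDiffWithinAt_Ioi x), hL.derivWithin (uniqueDiffWithinAt_Iio x),
    hfR.derivWithin (uniqueDiffWithinAt_Ioi x), hfL.derivWithin (uniqueDiffWithinAt_Iio x)]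
  ring

/-- **Prop. 5.4 (iv)**: "`(f) := Σ_H (H, ord_H(f))` determines a group homomorphism
`𝒦^×(C_p) → Div(C_p)`": `ord_λ(f + g) = ord_λ(f) + ord_λ(g)` for `f, g ∈ 𝒦(C_p)`, `λ > 0`.
[cite: ConnesConsani2017ScalingSite, Prop. 5.4 (iv)] -/
theorem IsCpRational.cpOrder_add (hp : 1 < p) {f g : ℝ → ℝ} (hf : IsCpRational p f)
    (hg : IsCpRational p g) {x : ℝ} (hx : 0 < x) :
    cpOrder (fun y => f y + g y) x = cpOrder f x + cpOrder g x :=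
  cpOrder_add_of_hasDerivWithinAt (hf.hasDerivWithinAt_Ioi hp hx).1 (hf.hasDerivWithinAt_Iio hp hx).1
    (hg.hasDerivWithinAt_Ioi hp hx).1 (hg.hasDerivWithinAt_Iio hp hx).1

/-- `ord_λ(f - g) = ord_λ(f) - ord_λ(g)` for `f, g ∈ 𝒦(C_p)`, `λ > 0`. [cite: ConnesConsani2017ScalingSite, Prop. 5.4 (iv)] -/
theorem IsCpRational.cpOrder_sub (hp : 1 < p) {f g : ℝ → ℝ} (hf : IsCpRational p f)
    (hg : IsCpRational p g) {x : ℝ} (hx : 0 < x) :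
    cpOrder (fun y => f y - g y) x = cpOrder f x - cpOrder g x := by
  have hgR : HasDerivWithinAt (fun y => -g y) (-derivWithin g (Ioi x) x) (Ioi x) x :=
    (hg.hasDerivWithinAt_Ioi hp hx).1.neg
  have hgL : HasDerivWithinAt (fun y => -g y) (-derivWithin g (Iio x) x) (Iio x) x :=
    (hg.hasDerivWithinAt_Iio hp hx).1.neg
  have h1 := cpOrder_add_of_hasDerivWithinAt (hf.hasDerivWithinAt_Ioi hp hx).1
    (hf.hasDerivWithinAt_Iio hp hx).1 hgR hgL
  have h2 := cpOrder_neg_of_hasDerivWithinAt (hg.hasDerivWithinAt_Ioi hp hx).1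
    (hg.hasDerivWithinAt_Iio hp hx).1
  have e : (fun y => f y - g y) = (fun y => f y + (fun y => -g y) y) := by
    funext y
    simp only [sub_eq_add_neg]
  rw [e, h1, h2, ← sub_eq_add_neg]

/-- **A rational function with zero divisor is constant**: all slopes over one period coincide
(`ord = 0` at every break point), and the closure relation `Σ h_j(λ_{j+1} - λ_j) = f(pλ₀) - f(λ₀) = 0`
forces the common slope to vanish. [cite: ConnesConsani2017ScalingSite, Thm. 5.12 (proof: "has the same divisor as f thus it differs from f by a constant") with Prop. 5.4 (v)] -/
theorem IsCpRational.exists_eq_const_of_cpOrder_eq_zero (hp : 1 < p) {f : ℝ → ℝ}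
    (hf : IsCpRational p f) (h0 : ∀ x, 0 < x → cpOrder f x = 0) :
    ∃ c : ℝ, ∀ x, 0 < x → f x = c := by
  classical
  have hp1 : (1 : ℝ) < p := by exact_mod_cast hp
  obtain ⟨T, hT, P, -, hPl, hPn, -⟩ := hf.exists_cpPieces_base_one hp ∅ (by simp)
  -- all slopes are equal to `h_0`
  have hslope : ∀ j, j ≤ P.n → P.h j = P.h 0 := by
    intro j hj
    induction j with
    | zero => rfl
    | succ j ih =>
      have h := P.cpOrder_lam_succ (j := j) (by omega)
      rw [h0 _ (P.lam_pos' (by omega))] at h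
      have hl : 0 < P.lam (j + 1) := P.lam_pos' (by omega)
      rcases mul_eq_zero.1 h.symm with h' | h'
      · exact absurd h' hl.ne'
      · rw [← ih (by omega)]
        linarith
  -- the common slope vanishes
  have hsum := P.sum_h_mul_eq
  rw [P.lam_last, hf.1 _ P.lam_pos, sub_self,
    Finset.sum_congr rfl fun j hj => by
      rw [hslope j (by simpa [Finset.mem_range, Nat.lt_succ_iff] using hj)],
    ← Finset.mul_sum, Finset.sum_range_sub (fun j => P.lam j), P.lam_last] at hsum
  have hh0 : P.h 0 = 0 := by
    rcases mul_eq_zero.1 hsum with h | h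
    · exact h
    · have := P.lam_pos
      nlinarith
  -- hence `f` is constant on the period `[1, p)` and everywhere by periodicity
  have hlam : ∀ j, j ≤ P.n + 1 → f (P.lam j) = f (P.lam 0) := by
    intro j hj
    induction j with
    | zero => rfl
    | succ j ih => rw [P.f_lam_succ (by omega), hslope j (by omega), hh0, ih (by omega)]; ring
  refine ⟨f 1, fun x hx => ?_⟩
  rw [hf.apply_eq_apply_fundRed hp one_pos hx]
  obtain ⟨hy1, hy2, -⟩ := fundRed_spec hp one_pos hx
  set y := fundRed p 1 x
  obtain ⟨j, hj, h1, h2⟩ := P.exists_piece_right (y := y) (by rwa [hPl, bpts_zero])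
    (by rw [hPl, hPn, bpts_of_card_lt (Nat.lt_succ_self _)]; simpa using hy2)
  rw [P.piece j hj y h1 h2.le, hslope j hj, hh0, hlam j (by omega), hPl, bpts_zero]
  ring

/-- **Two rational functions with the same divisor differ by a constant** (the last step of the
proof of Theorem 5.12). [cite: ConnesConsani2017ScalingSite, Thm. 5.12 (proof)] -/
theorem IsCpRational.exists_eq_add_const_of_cpOrder_eq (hp : 1 < p) {f g : ℝ → ℝ}
    (hf : IsCpRational p f) (hg : IsCpRational p g)
    (h : ∀ x, 0 < x → cpOrder f x = cpOrder g x) :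
    ∃ c : ℝ, ∀ x, 0 < x → f x = g x + c := by
  obtain ⟨c, hc⟩ := (hf.sub hp hg).exists_eq_const_of_cpOrder_eq_zero hp fun x hx => by
    rw [hf.cpOrder_sub hp hg hx, h x hx, sub_self]
  exact ⟨c, fun x hx => by linarith [show f x - g x = c from hc x hx]⟩

end Group


/-! ## Prop. 5.11 (normalised labels, weighted form): `F = Σ_i w_i Θ_{h_i,μ_i} - hλ`

The engine behind Prop. 5.11 and Theorem 5.12. Labels are normalised as in the proof of
Theorem 5.12 (`c_i := μ_i/h_i ∈ [1, p)`, i.e. `h_i ≤ μ_i < ph_i`), weights `w_i ∈ ℤ` (the source's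
`D₊ - D₋` has `w_i = ±1`). On the fundamental domain `[1, p]` each `Θ_{h_i,μ_i}` is the hinge
`0 ∨ (μ_i - h_iλ)` with its single break point at `c_i`, so `F` is affine between consecutive
points of `{1} ∪ {c_i} ∪ {p}` with slopes in `H_p`; the functional equation (38) and the two
relations `Σ w_i μ_i = deg D = 0`, `(p-1)h = Σ w_i h_i` give `F(pλ) = F(λ)`. -/

section ThetaComb

variable {p : ℕ} {ι : Type*}

/-- `F(λ) = Σ_{i ∈ s} w_i Θ_{h_i,μ_i}(λ) - hλ` (the function of Prop. 5.11 with integer weights).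
[cite: ConnesConsani2017ScalingSite, Prop. 5.11 eq. (39)] -/
def thetaComb (p : ℕ) (s : Finset ι) (w : ι → ℤ) (h μ : ι → ℝ) (a : ℝ) (x : ℝ) : ℝ :=
  (∑ i ∈ s, (w i : ℝ) * cpThetaHM p (h i) (μ i) x) - a * x

/-- The hinge normal form of `F` on the fundamental domain:
`G(λ) = Σ_i w_i (0 ∨ (μ_i - h_iλ)) - hλ`. [cite: ConnesConsani2017ScalingSite, Prop. 5.11 with Thm. 5.12 (proof)] -/
def thetaCombFD (s : Finset ι) (w : ι → ℤ) (h μ : ι → ℝ) (a : ℝ) (x : ℝ) : ℝ :=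
  (∑ i ∈ s, (w i : ℝ) * max 0 (μ i - h i * x)) - a * x

/-- The right slope of `G` at `u`: `-Σ_{i : u < c_i} w_i h_i - h`, `c_i = μ_i/h_i`.
[cite: ConnesConsani2017ScalingSite, Prop. 5.11 (proof: "each theta function Θ_{h_i,μ_i} contributes with the term δ(h_i,μ_i)")] -/
def thetaCombSlope (s : Finset ι) (w : ι → ℤ) (h μ : ι → ℝ) (a : ℝ) (u : ℝ) : ℝ :=
  -(∑ i ∈ s, if u < μ i / h i then (w i : ℝ) * h i else 0) - a

/-- **`F(pλ) = F(λ)`** when `Σ w_i μ_i = 0` (`deg D = 0`) and `(p-1)h = Σ w_i h_i`, by the functional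
equation `Θ_{h,μ}(pλ) = Θ_{h,μ}(λ) + hλ - μ`. [cite: ConnesConsani2017ScalingSite, Prop. 5.11 (proof, first display)] -/
theorem thetaComb_mul_p (hp : 1 < p) {s : Finset ι} {w : ι → ℤ} {h μ : ι → ℝ} {a : ℝ}
    (hl : ∀ i ∈ s, 0 < h i ∧ 0 < μ i) (hdeg : ∑ i ∈ s, (w i : ℝ) * μ i = 0)
    (hrel : ((p : ℝ) - 1) * a = ∑ i ∈ s, (w i : ℝ) * h i) {x : ℝ} (hx : 0 < x) :
    thetaComb p s w h μ a (p * x) = thetaComb p s w h μ a x := by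
  unfold thetaComb
  have e : ∀ i ∈ s, (w i : ℝ) * cpThetaHM p (h i) (μ i) (p * x) =
      (w i : ℝ) * cpThetaHM p (h i) (μ i) x + ((w i : ℝ) * h i) * x - (w i : ℝ) * μ i := by
    intro i hi
    rw [cpThetaHM_mul_p hp (hl i hi).1 (hl i hi).2 hx]
    ring
  rw [Finset.sum_congr rfl e, Finset.sum_sub_distrib, Finset.sum_add_distrib, ← Finset.sum_mul,
    hdeg, ← hrel]
  ring

/-- **On `[1, p]`, `F` is the hinge combination `G`** (normalised labels).
[cite: ConnesConsani2017ScalingSite, Thm. 5.12 (proof) with Lemma 5.10] -/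
theorem thetaComb_eq_FD (hp : 1 < p) {s : Finset ι} {w : ι → ℤ} {h μ : ι → ℝ} {a : ℝ}
    (hl : ∀ i ∈ s, 0 < h i ∧ h i ≤ μ i ∧ μ i < p * h i) {x : ℝ} (hx1 : 1 ≤ x) (hx2 : x ≤ p) :
    thetaComb p s w h μ a x = thetaCombFD s w h μ a x := by
  unfold thetaComb thetaCombFD
  rw [Finset.sum_congr rfl fun i hi => by
    rw [cpThetaHM_eq_max hp (hl i hi).1 (hl i hi).2.1 (hl i hi).2.2 hx1 hx2]]

/-- Evaluation of one hinge: `0 ∨ (μ - hλ) = μ - hλ` for `λ ≤ μ/h` and `= 0` for `μ/h ≤ λ` (`h > 0`).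
[cite: ConnesConsani2017ScalingSite, Lemma 5.10 (proof of (i))] -/
theorem max_label_of_le {h μ x : ℝ} (hh : 0 < h) (hx : x ≤ μ / h) : max 0 (μ - h * x) = μ - h * x :=
  max_eq_right (by rw [le_div_iff₀ hh] at hx; linarith)

/-- Evaluation of one hinge past its break point. [cite: ConnesConsani2017ScalingSite, Lemma 5.10 (proof of (i))] -/
theorem max_label_of_ge {h μ x : ℝ} (hh : 0 < h) (hx : μ / h ≤ x) : max 0 (μ - h * x) = 0 :=
  max_eq_left (by rw [div_le_iff₀ hh] at hx; linarith)

/-- **Affine pieces of `G`**: if no break point `c_i = μ_i/h_i` lies strictly between `u ≤ v`, then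
`G(λ) = G(u) + σ(u)(λ - u)` on `[u, v]`, `σ(u)` the right slope `thetaCombSlope`.
[cite: ConnesConsani2017ScalingSite, Prop. 5.11 (proof) with Lemma 5.10 (i)] -/
theorem thetaCombFD_affine {s : Finset ι} {w : ι → ℤ} {h μ : ι → ℝ} {a : ℝ}
    (hh : ∀ i ∈ s, 0 < h i) {u v : ℝ} (hgap : ∀ i ∈ s, μ i / h i ≤ u ∨ v ≤ μ i / h i) {x : ℝ}
    (hx1 : u ≤ x) (hx2 : x ≤ v) :
    thetaCombFD s w h μ a x = thetaCombFD s w h μ a u + thetaCombSlope s w h μ a u * (x - u) := by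
  classical
  unfold thetaCombFD thetaCombSlope
  have e : ∀ i ∈ s, (w i : ℝ) * max 0 (μ i - h i * x) - (w i : ℝ) * max 0 (μ i - h i * u) =
      -(if u < μ i / h i then (w i : ℝ) * h i else 0) * (x - u) := by
    intro i hi
    by_cases hu : u < μ i / h i
    · have hv : v ≤ μ i / h i := (hgap i hi).resolve_left (not_le.2 hu)
      rw [if_pos hu, max_label_of_le (hh i hi) (hx2.trans hv), max_label_of_le (hh i hi) hu.le]
      ring
    · push Not at hu
      rw [if_neg (not_lt.2 hu), max_label_of_ge (hh i hi) hu, max_label_of_ge (hh i hi) (hu.trans hx1)]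
      ring
  have hsum : (∑ i ∈ s, (w i : ℝ) * max 0 (μ i - h i * x)) =
      (∑ i ∈ s, (w i : ℝ) * max 0 (μ i - h i * u)) +
        -(∑ i ∈ s, if u < μ i / h i then (w i : ℝ) * h i else 0) * (x - u) := by
    rw [neg_mul, Finset.sum_mul, ← Finset.sum_neg_distrib, ← Finset.sum_add_distrib]
    refine Finset.sum_congr rfl fun i hi => ?_
    linear_combination e i hi
  rw [hsum]
  ring

/-- The slopes of `G` lie in `H_p` (`w_i ∈ ℤ`, `h_i, h ∈ H_p`). [cite: ConnesConsani2017ScalingSite, Prop. 5.11 ("piecewise affine with slopes in H_p")] -/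
theorem isPFraction_thetaCombSlope (hp : 1 < p) {s : Finset ι} {w : ι → ℤ} {h μ : ι → ℝ} {a : ℝ}
    (hH : ∀ i ∈ s, IsPFraction p (h i)) (ha : IsPFraction p a) (u : ℝ) :
    IsPFraction p (thetaCombSlope s w h μ a u) := by
  classical
  unfold thetaCombSlope
  refine (IsPFraction.sum (zero_lt_one.trans hp).ne' s _ fun i hi => ?_).neg.sub
    (zero_lt_one.trans hp).ne' ha
  split_ifs
  · exact (hH i hi).int_mul (w i)
  · exact isPFraction_zero p

/-- The break points of `G` inside `(1, p)`: the `c_i = μ_i/h_i` with `c_i > 1`.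
[cite: ConnesConsani2017ScalingSite, Thm. 5.12 (proof: "μh⁻¹ ∈ [1,p)")] -/
def thetaCombBpts (s : Finset ι) (h μ : ι → ℝ) : Finset ℝ := by
  classical
  exact (s.image fun i => μ i / h i).filter fun t => 1 < t

/-- The break points lie in `(1, p)`. [cite: ConnesConsani2017ScalingSite, Thm. 5.12 (proof)] -/
theorem thetaCombBpts_bound {s : Finset ι} {h μ : ι → ℝ}
    (hl : ∀ i ∈ s, 0 < h i ∧ h i ≤ μ i ∧ μ i < p * h i) :
    ∀ t ∈ thetaCombBpts s h μ, 1 < t ∧ t < p := by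
  classical
  intro t ht
  unfold thetaCombBpts at ht
  rw [Finset.mem_filter, Finset.mem_image] at ht
  obtain ⟨⟨i, hi, rfl⟩, h1⟩ := ht
  exact ⟨h1, by rw [div_lt_iff₀ (hl i hi).1]; exact (hl i hi).2.2⟩

/-- Every `c_i` is a break point or the base point `1`. [cite: ConnesConsani2017ScalingSite, Thm. 5.12 (proof)] -/
theorem label_mem_thetaCombBpts {s : Finset ι} {h μ : ι → ℝ}
    (hl : ∀ i ∈ s, 0 < h i ∧ h i ≤ μ i ∧ μ i < p * h i) {i : ι} (hi : i ∈ s) :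
    μ i / h i ∈ thetaCombBpts s h μ ∨ μ i / h i = 1 ∨ μ i / h i = (p : ℝ) := by
  classical
  have h1 : 1 ≤ μ i / h i := by rw [le_div_iff₀ (hl i hi).1, one_mul]; exact (hl i hi).2.1
  rcases h1.eq_or_lt with h | h
  · exact Or.inr (Or.inl h.symm)
  · left
    unfold thetaCombBpts
    rw [Finset.mem_filter, Finset.mem_image]
    exact ⟨⟨i, hi, rfl⟩, h⟩

/-- No `c_i` lies strictly inside a piece `[t_j, t_{j+1}]` of the partition of `[1, p]` by the break
points. [cite: ConnesConsani2017ScalingSite, Thm. 5.12 (proof)] -/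
theorem label_le_or_ge_bpts (hp : 1 < p) {s : Finset ι} {h μ : ι → ℝ}
    (hl : ∀ i ∈ s, 0 < h i ∧ h i ≤ μ i ∧ μ i < p * h i) {j : ℕ}
    (hj : j ≤ (thetaCombBpts s h μ).card) :
    ∀ i ∈ s, μ i / h i ≤ bpts p (thetaCombBpts s h μ) j ∨
      bpts p (thetaCombBpts s h μ) (j + 1) ≤ μ i / h i := by
  intro i hi
  by_cases hc : μ i / h i ≤ bpts p (thetaCombBpts s h μ) j
  · exact Or.inl hc
  · right
    push Not at hc
    by_contra hcon
    push Not at hcon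
    exact not_mem_Ioo_bpts hp (thetaCombBpts_bound hl) (label_mem_thetaCombBpts hl hi) hj
      ⟨hc, hcon⟩

/-- `F` is a class function: `F(λ) = F(λ̄)`, `λ̄ ∈ [1, p)` the representative.
[cite: ConnesConsani2017ScalingSite, Prop. 5.11 ("fulfills f(pλ) = f(λ)")] -/
theorem thetaComb_eq_fundRed (hp : 1 < p) {s : Finset ι} {w : ι → ℤ} {h μ : ι → ℝ} {a : ℝ}
    (hl : ∀ i ∈ s, 0 < h i ∧ 0 < μ i) (hdeg : ∑ i ∈ s, (w i : ℝ) * μ i = 0)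
    (hrel : ((p : ℝ) - 1) * a = ∑ i ∈ s, (w i : ℝ) * h i) {x : ℝ} (hx : 0 < x) :
    thetaComb p s w h μ a x = thetaComb p s w h μ a (fundRed p 1 x) := by
  obtain ⟨h1, -, h3⟩ := fundRed_spec hp one_pos hx
  conv_lhs => rw [h3]
  exact periodic_zpow (zero_lt_one.trans hp) (fun t ht => thetaComb_mul_p hp hl hdeg hrel ht) _ _
    (zero_lt_one.trans_le h1)

/-- **Piece data of `F` based at `1`** (break points `thetaCombBpts`, slopes `thetaCombSlope`):
"continuous, piecewise affine with slopes in `H_p`". [cite: ConnesConsani2017ScalingSite, Prop. 5.11] -/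
theorem thetaComb_exists_cpPieces (hp : 1 < p) {s : Finset ι} {w : ι → ℤ} {h μ : ι → ℝ} {a : ℝ}
    (hl : ∀ i ∈ s, 0 < h i ∧ h i ≤ μ i ∧ μ i < p * h i) (hH : ∀ i ∈ s, IsPFraction p (h i))
    (ha : IsPFraction p a) (hdeg : ∑ i ∈ s, (w i : ℝ) * μ i = 0)
    (hrel : ((p : ℝ) - 1) * a = ∑ i ∈ s, (w i : ℝ) * h i) :
    ∃ P : CpPieces p (thetaComb p s w h μ a), P.lam = bpts p (thetaCombBpts s h μ) ∧
      P.n = (thetaCombBpts s h μ).card ∧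
      ∀ j, P.h j = thetaCombSlope s w h μ a (bpts p (thetaCombBpts s h μ) j) := by
  have hp1 : (1 : ℝ) ≤ p := by exact_mod_cast hp.le
  have hl' : ∀ i ∈ s, 0 < h i ∧ 0 < μ i := fun i hi => ⟨(hl i hi).1, (hl i hi).1.trans_le (hl i hi).2.1⟩
  set T := thetaCombBpts s h μ with hT
  have hTb := thetaCombBpts_bound hl
  refine ⟨CpPieces.ofFinset hp T hTb (F := thetaCombFD s w h μ a) (g := thetaComb p s w h μ a)
    (fun x hx => ?_) ?_ (fun j => thetaCombSlope s w h μ a (bpts p T j))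
    (fun j _ => isPFraction_thetaCombSlope hp hH ha _) ?_, rfl, rfl, fun j => rfl⟩
  · obtain ⟨h1, h2, -⟩ := fundRed_spec hp one_pos hx
    rw [thetaComb_eq_fundRed hp hl' hdeg hrel hx,
      thetaComb_eq_FD hp hl h1 (by rw [mul_one] at h2; exact h2.le)]
  · rw [← thetaComb_eq_FD hp hl hp1 le_rfl, ← thetaComb_eq_FD hp hl le_rfl hp1]
    have := thetaComb_mul_p hp hl' hdeg hrel one_pos (s := s) (w := w) (a := a)
    rwa [mul_one] at this
  · intro j hj x hx1 hx2
    exact thetaCombFD_affine (fun i hi => (hl i hi).1) (label_le_or_ge_bpts hp hl hj) hx1 hx2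

/-- **Prop. 5.11, first half (normalised labels): `F ∈ 𝒦(C_p)`.**
[cite: ConnesConsani2017ScalingSite, Prop. 5.11] -/
theorem thetaComb_isCpRational (hp : 1 < p) {s : Finset ι} {w : ι → ℤ} {h μ : ι → ℝ} {a : ℝ}
    (hl : ∀ i ∈ s, 0 < h i ∧ h i ≤ μ i ∧ μ i < p * h i) (hH : ∀ i ∈ s, IsPFraction p (h i))
    (ha : IsPFraction p a) (hdeg : ∑ i ∈ s, (w i : ℝ) * μ i = 0)
    (hrel : ((p : ℝ) - 1) * a = ∑ i ∈ s, (w i : ℝ) * h i) :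
    IsCpRational p (thetaComb p s w h μ a) := by
  obtain ⟨P, -, -, -⟩ := thetaComb_exists_cpPieces hp hl hH ha hdeg hrel
  have hl' : ∀ i ∈ s, 0 < h i ∧ 0 < μ i := fun i hi => ⟨(hl i hi).1, (hl i hi).1.trans_le (hl i hi).2.1⟩
  exact P.isCpRational fun x hx => thetaComb_mul_p hp hl' hdeg hrel hx

/-- The divisor `Σ_i w_i δ(h_i, μ_i)` as a function of `λ > 0`.
[cite: ConnesConsani2017ScalingSite, Prop. 5.11 ("D₊ = Σ δ(h_i,μ_i)", "D₋ = Σ δ(h'_j,μ'_j)")] -/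
def thetaCombDiv (p : ℕ) (s : Finset ι) (w : ι → ℤ) (h μ : ι → ℝ) (x : ℝ) : ℝ :=
  ∑ i ∈ s, (w i : ℝ) * thetaDelta p (h i) (μ i) x

/-- `Σ_i w_i δ(h_i, μ_i)` is a class function. [cite: ConnesConsani2017ScalingSite, §5.3 (definition of δ(h,μ))] -/
theorem thetaCombDiv_mul_p (hp : 1 < p) (s : Finset ι) (w : ι → ℤ) (h μ : ι → ℝ) (x : ℝ) :
    thetaCombDiv p s w h μ (p * x) = thetaCombDiv p s w h μ x := by
  unfold thetaCombDiv
  exact Finset.sum_congr rfl fun i _ => by rw [thetaDelta_mul_p hp]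

/-- `Σ_i w_i δ(h_i, μ_i)` on the fundamental domain (normalised labels): the value at `λ ∈ [1, p)` is
`Σ_{i : c_i = λ} w_i μ_i`. [cite: ConnesConsani2017ScalingSite, §5.3 (definition of δ(h,μ))] -/
theorem thetaCombDiv_of_mem (hp : 1 < p) {s : Finset ι} (w : ι → ℤ) {h μ : ι → ℝ}
    (hl : ∀ i ∈ s, 0 < h i ∧ h i ≤ μ i ∧ μ i < p * h i) {y : ℝ} (hy1 : 1 ≤ y) (hy2 : y < p) :
    thetaCombDiv p s w h μ y = ∑ i ∈ s, if y = μ i / h i then (w i : ℝ) * μ i else 0 := by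
  classical
  unfold thetaCombDiv
  refine Finset.sum_congr rfl fun i hi => ?_
  have hc1 : 1 ≤ μ i / h i := by rw [le_div_iff₀ (hl i hi).1, one_mul]; exact (hl i hi).2.1
  have hc2 : μ i / h i < p := by rw [div_lt_iff₀ (hl i hi).1]; exact (hl i hi).2.2
  rw [thetaDelta_of_mem hp hc1 hc2 hy1 hy2, mul_ite, mul_zero]

/-- **Prop. 5.11, second half (normalised labels): `(F) = Σ_i w_i δ(h_i, μ_i)`** — "the divisor of
`f` is equal to `D` by construction since each theta function `Θ_{h_i,μ_i}` […] contributes with the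
term `δ(h_i, μ_i)` […] while `-hλ` does not contribute at all". At a break point `c ∈ (1, p)` the
slope of `G` jumps by `Σ_{c_i = c} w_i h_i`, so `ord_c F = c Σ_{c_i = c} w_i h_i = Σ_{c_i = c} w_i μ_i`;
at the base point `1` the left slope is `p` times the slope `-h` left of `p`, and
`(p-1)h = Σ w_i h_i` leaves exactly `Σ_{c_i = 1} w_i μ_i`. [cite: ConnesConsani2017ScalingSite, Prop. 5.11 (proof)] -/
theorem cpOrder_thetaComb (hp : 1 < p) {s : Finset ι} {w : ι → ℤ} {h μ : ι → ℝ} {a : ℝ}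
    (hl : ∀ i ∈ s, 0 < h i ∧ h i ≤ μ i ∧ μ i < p * h i) (hH : ∀ i ∈ s, IsPFraction p (h i))
    (ha : IsPFraction p a) (hdeg : ∑ i ∈ s, (w i : ℝ) * μ i = 0)
    (hrel : ((p : ℝ) - 1) * a = ∑ i ∈ s, (w i : ℝ) * h i) {x : ℝ} (hx : 0 < x) :
    cpOrder (thetaComb p s w h μ a) x = thetaCombDiv p s w h μ x := by
  classical
  have hp0 : 0 < p := zero_lt_one.trans hp
  have hl' : ∀ i ∈ s, 0 < h i ∧ 0 < μ i := fun i hi =>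
    ⟨(hl i hi).1, (hl i hi).1.trans_le (hl i hi).2.1⟩
  have hc1 : ∀ i ∈ s, 1 ≤ μ i / h i := fun i hi => by
    rw [le_div_iff₀ (hl i hi).1, one_mul]; exact (hl i hi).2.1
  have hc2 : ∀ i ∈ s, μ i / h i < p := fun i hi => by
    rw [div_lt_iff₀ (hl i hi).1]; exact (hl i hi).2.2
  have hcμ : ∀ i ∈ s, μ i / h i * h i = μ i := fun i hi => div_mul_cancel₀ _ (hl i hi).1.ne'
  obtain ⟨P, hPl, hPn, hPh⟩ := thetaComb_exists_cpPieces hp hl hH ha hdeg hrel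
  have hTb := thetaCombBpts_bound hl
  have hper : ∀ t, 0 < t → thetaComb p s w h μ a (p * t) = thetaComb p s w h μ a t :=
    fun t ht => thetaComb_mul_p hp hl' hdeg hrel ht
  obtain ⟨k, y, hy0, hy1, rfl, hord⟩ := P.exists_cpOrder_eq hp hper hx
  have hy : 0 < y := P.lam_pos.trans_le hy0
  rw [hord, show thetaCombDiv p s w h μ ((p : ℝ) ^ k * y) = thetaCombDiv p s w h μ y from
    periodic_zpow hp0 (fun t _ => thetaCombDiv_mul_p hp s w h μ t) k y hy]
  rw [hPl, bpts_zero] at hy0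
  rw [hPl, hPn, bpts_of_card_lt (Nat.lt_succ_self _)] at hy1
  rw [thetaCombDiv_of_mem hp w hl hy0 hy1]
  obtain ⟨j, hj, h1, h2⟩ := exists_bpts_piece_right (T := thetaCombBpts s h μ) hy0 hy1
  rcases h1.eq_or_lt with heq | hlt
  · -- `y` is the break point `t_j`
    rcases Nat.eq_zero_or_pos j with rfl | hjpos
    · -- the base point `y = 1`
      rw [bpts_zero] at heq
      subst heq
      have hord1 := P.cpOrder_lam_zero hp0 hper
      rw [hPh, hPh, hPn, hPl, bpts_zero, one_mul] at hord1
      rw [hord1]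
      have hlast : thetaCombSlope s w h μ a (bpts p (thetaCombBpts s h μ) (thetaCombBpts s h μ).card) = -a := by
        unfold thetaCombSlope
        rw [Finset.sum_eq_zero fun i hi => ?_, neg_zero, zero_sub]
        rw [if_neg]
        push Not
        rcases label_mem_thetaCombBpts hl hi with hm | hm | hm
        · obtain ⟨m, -, hm2, hm3⟩ := exists_bpts_eq (p := p) hm
          rw [← hm3]
          exact bpts_le_of_le hp hTb hm2 (by omega)
        · rw [hm]
          exact one_le_bpts hp hTb _
        · exact absurd hm (hc2 i hi).ne
      rw [hlast]
      unfold thetaCombSlope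
      have e : ∀ i ∈ s, (if (1 : ℝ) = μ i / h i then (w i : ℝ) * μ i else 0) =
          (w i : ℝ) * h i - (if (1 : ℝ) < μ i / h i then (w i : ℝ) * h i else 0) := by
        intro i hi
        rcases (hc1 i hi).eq_or_lt with h1' | h1'
        · rw [if_pos h1', if_neg (by rw [← h1']; exact lt_irrefl _)]
          have hμh : μ i = h i := by rw [← hcμ i hi, ← h1', one_mul]
          rw [hμh, sub_zero]
        · rw [if_neg h1'.ne, if_pos h1', sub_self]
      rw [Finset.sum_congr rfl e, Finset.sum_sub_distrib, ← hrel]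
      ring
    · -- an inner break point `y = t_{j'+1}`
      obtain ⟨j', rfl⟩ : ∃ j', j = j' + 1 := ⟨j - 1, by omega⟩
      have hordj := P.cpOrder_lam_succ (j := j') (by omega)
      rw [hPh, hPh, hPl] at hordj
      rw [← heq, hordj]
      unfold thetaCombSlope
      have hgap := label_le_or_ge_bpts hp hl (j := j') (le_of_lt (by omega))
      have e : ∀ i ∈ s, (if bpts p (thetaCombBpts s h μ) (j' + 1) = μ i / h i then (w i : ℝ) * μ i else 0) =
          bpts p (thetaCombBpts s h μ) (j' + 1) * ((if bpts p (thetaCombBpts s h μ) j' < μ i / h i then (w i : ℝ) * h i else 0) -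
            (if bpts p (thetaCombBpts s h μ) (j' + 1) < μ i / h i then (w i : ℝ) * h i else 0)) := by
        intro i hi
        rcases hgap i hi with hle | hge
        · have hlt' : μ i / h i < bpts p (thetaCombBpts s h μ) (j' + 1) :=
            hle.trans_lt (bpts_lt_succ hp hTb (by omega))
          rw [if_neg hlt'.ne', if_neg (not_lt.2 hle), if_neg (not_lt.2 hlt'.le)]
          ring
        · rw [if_pos ((bpts_lt_succ hp hTb (by omega)).trans_le hge)]
          rcases hge.eq_or_lt with heq' | hlt'
          · rw [if_pos heq', if_neg (by rw [heq']; exact lt_irrefl _), ← hcμ i hi, ← heq']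
            ring
          · rw [if_neg hlt'.ne, if_pos hlt']
            ring
      rw [Finset.sum_congr rfl e, ← Finset.mul_sum, Finset.sum_sub_distrib]
      ring
  · -- `y` inside a piece: the order vanishes and `y` is no `c_i`
    have h0 := P.cpOrder_of_mem_Ioo (j := j) (by omega) (by rw [hPl]; exact hlt)
      (by rw [hPl]; exact h2)
    rw [h0, eq_comm]
    refine Finset.sum_eq_zero fun i hi => ?_
    rw [if_neg]
    intro hyc
    exact not_mem_Ioo_bpts hp hTb (label_mem_thetaCombBpts hl hi) hj
      ⟨hyc ▸ hlt, hyc ▸ h2⟩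

end ThetaComb


/-! ## Proposition 5.11 (printed two-family form, labels normalised as in Theorem 5.12) -/

section Prop511

variable {p : ℕ} {ι κ : Type*}

/-- **Connes–Consani 2017, Proposition 5.11** (labels normalised as in the proof of Theorem 5.12,
`μ_i h_i⁻¹, μ'_j h'_j⁻¹ ∈ [1, p)`; general labels reduce to these by `Θ_{ph,μ} = Θ_{h,μ} + hλ - μ`
and `δ(ph, μ) = δ(h, μ)`, `cpThetaHM_pmul`, `thetaDelta_pmul`): "Let `D = D₊ - D₋ ∈ Div(C_p)` […]
`D₊ = Σ δ(h_i, μ_i)` and `D₋ = Σ δ(h'_j, μ'_j)`. Then, if `deg(D) = 0` and `h ∈ H_p` fulfills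
`(p-1)h = Σ h_i - Σ h'_j`, the following function `f(λ) := Σ_i Θ_{h_i,μ_i}(λ) - Σ_j Θ_{h'_j,μ'_j}(λ) - hλ`
is continuous, piecewise affine with slopes in `H_p`, fulfills `f(pλ) = f(λ)` `∀λ ∈ ℝ₊*` and one
has: `div(f) = D`." — `f ∈ 𝒦(C_p)` (`IsCpRational`, which contains the periodicity) and
`ord_λ f = D₊(λ) - D₋(λ)` for every `λ > 0`.
The printed generality (arbitrary labels in `H_p⁺ × ℝ₊*`) is `ConnesConsani2017_prop_5_11_general` below.
[cite: ConnesConsani2017ScalingSite, Prop. 5.11] -/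
theorem ConnesConsani2017_prop_5_11 (hp : p.Prime) (s : Finset ι) (t : Finset κ) (h μ : ι → ℝ)
    (h' μ' : κ → ℝ) (a : ℝ)
    (hl : ∀ i ∈ s, IsPFraction p (h i) ∧ 0 < h i ∧ h i ≤ μ i ∧ μ i < p * h i)
    (hl' : ∀ j ∈ t, IsPFraction p (h' j) ∧ 0 < h' j ∧ h' j ≤ μ' j ∧ μ' j < p * h' j)
    (ha : IsPFraction p a) (hdeg : ∑ i ∈ s, μ i = ∑ j ∈ t, μ' j)
    (hrel : ((p : ℝ) - 1) * a = ∑ i ∈ s, h i - ∑ j ∈ t, h' j) :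
    IsCpRational p (fun x => (∑ i ∈ s, cpThetaHM p (h i) (μ i) x) -
        (∑ j ∈ t, cpThetaHM p (h' j) (μ' j) x) - a * x) ∧
      ∀ x, 0 < x →
        cpOrder (fun x => (∑ i ∈ s, cpThetaHM p (h i) (μ i) x) -
            (∑ j ∈ t, cpThetaHM p (h' j) (μ' j) x) - a * x) x =
          (∑ i ∈ s, thetaDelta p (h i) (μ i) x) - ∑ j ∈ t, thetaDelta p (h' j) (μ' j) x := by
  have hp1 := hp.one_lt
  -- one weighted family on `ι ⊕ κ`
  set w : ι ⊕ κ → ℤ := Sum.elim (fun _ => 1) (fun _ => -1) with hw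
  set H : ι ⊕ κ → ℝ := Sum.elim h h' with hH
  set M : ι ⊕ κ → ℝ := Sum.elim μ μ' with hM
  have hfun : (fun x => (∑ i ∈ s, cpThetaHM p (h i) (μ i) x) -
      (∑ j ∈ t, cpThetaHM p (h' j) (μ' j) x) - a * x) = thetaComb p (s.disjSum t) w H M a := by
    funext x
    unfold thetaComb
    rw [Finset.sum_disjSum]
    simp only [hw, hH, hM, Sum.elim_inl, Sum.elim_inr, Int.cast_one, one_mul, Int.cast_neg,
      neg_one_mul, Finset.sum_neg_distrib]
    ring
  have hlS : ∀ i ∈ s.disjSum t, 0 < H i ∧ H i ≤ M i ∧ M i < p * H i := by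
    rintro (i | j) hi
    · rw [Finset.inl_mem_disjSum] at hi
      exact ⟨(hl i hi).2.1, (hl i hi).2.2.1, (hl i hi).2.2.2⟩
    · rw [Finset.inr_mem_disjSum] at hi
      exact ⟨(hl' j hi).2.1, (hl' j hi).2.2.1, (hl' j hi).2.2.2⟩
  have hHS : ∀ i ∈ s.disjSum t, IsPFraction p (H i) := by
    rintro (i | j) hi
    · rw [Finset.inl_mem_disjSum] at hi
      exact (hl i hi).1
    · rw [Finset.inr_mem_disjSum] at hi
      exact (hl' j hi).1
  have hdegS : ∑ i ∈ s.disjSum t, (w i : ℝ) * M i = 0 := by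
    rw [Finset.sum_disjSum]
    simp only [hw, hM, Sum.elim_inl, Sum.elim_inr, Int.cast_one, one_mul, Int.cast_neg,
      neg_one_mul, Finset.sum_neg_distrib, hdeg]
    ring
  have hrelS : ((p : ℝ) - 1) * a = ∑ i ∈ s.disjSum t, (w i : ℝ) * H i := by
    rw [Finset.sum_disjSum]
    simp only [hw, hH, Sum.elim_inl, Sum.elim_inr, Int.cast_one, one_mul, Int.cast_neg,
      neg_one_mul, Finset.sum_neg_distrib, hrel]
    ring
  refine ⟨hfun ▸ thetaComb_isCpRational hp1 hlS hHS ha hdegS hrelS, fun x hx => ?_⟩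
  rw [hfun, cpOrder_thetaComb hp1 hlS hHS ha hdegS hrelS hx]
  unfold thetaCombDiv
  rw [Finset.sum_disjSum]
  simp only [hw, hH, hM, Sum.elim_inl, Sum.elim_inr, Int.cast_one, one_mul, Int.cast_neg,
    neg_one_mul, Finset.sum_neg_distrib]
  ring

end Prop511

/-! ## Theorem 5.12: the canonical decomposition of `f ∈ 𝒦(C_p)` -/

section Thm512

variable {p : ℕ} {f : ℝ → ℝ}

/-- **The principal divisor `(f) := Σ_H (H, ord_H(f))` of `f ∈ 𝒦(C_p)`** as a `CpDivisor`
(Prop. 5.4 (iv): finitely many non-zero orders per period, `ord_λ f ∈ λH_p`).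
[cite: ConnesConsani2017ScalingSite, Prop. 5.4 (iv)] -/
def IsCpRational.divisor (hp : 1 < p) (hf : IsCpRational p f) : CpDivisor p where
  toFun := cpOrder f
  periodic x hx := (Classical.choice hf.nonempty_cpPieces).cpOrder_mul_p hp hf.1 hx
  mem x hx := by
    unfold cpOrder
    rw [mul_div_cancel_left₀ _ hx.ne']
    exact (hf.hasDerivWithinAt_Ioi hp hx).2.sub (zero_lt_one.trans hp).ne'
      (hf.hasDerivWithinAt_Iio hp hx).2
  finite_support := (hf.finsum_cpOrder_eq_zero hp).1.subset fun x hx => ⟨⟨hx.1, hx.2.1⟩, hx.2.2⟩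

/-- The values of `(f)`. [cite: ConnesConsani2017ScalingSite, Prop. 5.4 (iv)] -/
theorem IsCpRational.divisor_apply (hp : 1 < p) (hf : IsCpRational p f) (x : ℝ) :
    (hf.divisor hp).toFun x = cpOrder f x := rfl

/-- `(f)` is principal. [cite: ConnesConsani2017ScalingSite, Prop. 5.4 (iv)] -/
theorem IsCpRational.divisor_isPrincipal (hp : 1 < p) (hf : IsCpRational p f) :
    (hf.divisor hp).IsPrincipal :=
  ⟨f, hf, fun _ _ => rfl⟩

/-- The support points of `(f)` in the fundamental domain `[1, p)` (a finite set, Prop. 5.4 (iv)).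
[cite: ConnesConsani2017ScalingSite, Prop. 5.4 (iv)] -/
def IsCpRational.divSupport (hp : 1 < p) (hf : IsCpRational p f) : Finset ℝ :=
  (hf.finsum_cpOrder_eq_zero hp).1.toFinset

/-- Membership in the support. [cite: ConnesConsani2017ScalingSite, Prop. 5.4 (iv)] -/
theorem IsCpRational.mem_divSupport (hp : 1 < p) (hf : IsCpRational p f) {c : ℝ} :
    c ∈ hf.divSupport hp ↔ (1 ≤ c ∧ c < p) ∧ cpOrder f c ≠ 0 := by
  unfold IsCpRational.divSupport
  rw [Set.Finite.mem_toFinset, mem_inter_iff, mem_Ico, Function.mem_support]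

/-- **Connes–Consani 2017, Theorem 5.12 (canonical decomposition)**, `p` prime: "Let `f ∈ 𝒦(C_p)`.
Then `f` admits the following canonical decomposition
`f(λ) = Σ_i Θ_{h_i,μ_i}(λ) - Σ_j Θ_{h'_j,μ'_j}(λ) - hλ + c` where `c ∈ ℝ`,
`(p-1)h = Σ h_i - Σ h'_j` and `h_i ≤ μ_i < ph_i`, `h'_j ≤ μ'_j < ph'_j`." Here with the canonical
data of the printed proof: `i` runs over the points `c ∈ [1, p)` with `ord_c f > 0`, `j` over those
with `ord_c f < 0`, labels `h_c = |ord_c f|/c ∈ H_p`, `μ_c = |ord_c f|` (so `μ_c h_c⁻¹ = c ∈ [1, p)`),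
and `h = (Σ_{c} ord_c f / c)/(p - 1) ∈ H_p` (because `χ((f)) = 0`, Prop. 5.5 (ii)).
[cite: ConnesConsani2017ScalingSite, Thm. 5.12] -/
theorem ConnesConsani2017_thm_5_12 (hp : p.Prime) (hf : IsCpRational p f) :
    (∀ c ∈ hf.divSupport hp.one_lt, IsPFraction p (|cpOrder f c| / c) ∧ 0 < |cpOrder f c| / c ∧
        |cpOrder f c| / c ≤ |cpOrder f c| ∧ |cpOrder f c| < p * (|cpOrder f c| / c)) ∧
      IsPFraction p ((∑ c ∈ hf.divSupport hp.one_lt, cpOrder f c / c) / ((p : ℝ) - 1)) ∧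
      ((p : ℝ) - 1) * ((∑ c ∈ hf.divSupport hp.one_lt, cpOrder f c / c) / ((p : ℝ) - 1)) =
        (∑ c ∈ (hf.divSupport hp.one_lt).filter (fun c => 0 < cpOrder f c), |cpOrder f c| / c) -
          ∑ c ∈ (hf.divSupport hp.one_lt).filter (fun c => cpOrder f c < 0), |cpOrder f c| / c ∧
      ∃ κ : ℝ, ∀ x, 0 < x →
        f x = (∑ c ∈ (hf.divSupport hp.one_lt).filter (fun c => 0 < cpOrder f c),
            cpThetaHM p (|cpOrder f c| / c) (|cpOrder f c|) x) -
          (∑ c ∈ (hf.divSupport hp.one_lt).filter (fun c => cpOrder f c < 0),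
            cpThetaHM p (|cpOrder f c| / c) (|cpOrder f c|) x) -
          (∑ c ∈ hf.divSupport hp.one_lt, cpOrder f c / c) / ((p : ℝ) - 1) * x + κ := by
  classical
  have hp1 := hp.one_lt
  have hp0 := hp.pos
  have hpR : (1 : ℝ) < p := by exact_mod_cast hp1
  set D := cpOrder f with hD
  set S := hf.divSupport hp1 with hSdef
  have hmem : ∀ {c}, c ∈ S ↔ (1 ≤ c ∧ c < p) ∧ D c ≠ 0 := hf.mem_divSupport hp1
  -- the weights `w_c = ±1` and the identities `w_c μ_c = ord_c f`, `w_c h_c = ord_c f / c`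
  set w : ℝ → ℤ := fun c => if 0 < D c then 1 else -1 with hw
  have hwμ : ∀ c ∈ S, (w c : ℝ) * |D c| = D c := by
    intro c hc
    by_cases h0 : 0 < D c
    · simp only [hw, if_pos h0, Int.cast_one, one_mul, abs_of_pos h0]
    · have hneg : D c < 0 := lt_of_le_of_ne (not_lt.1 h0) (hmem.1 hc).2
      simp only [hw, if_neg h0, Int.cast_neg, Int.cast_one, neg_one_mul, abs_of_neg hneg, neg_neg]
  have hwh : ∀ c ∈ S, (w c : ℝ) * (|D c| / c) = D c / c := by
    intro c hc
    rw [← mul_div_assoc, hwμ c hc]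
  -- `ord_c f / c ∈ H_p`
  have hDc : ∀ c, 0 < c → IsPFraction p (D c / c) := by
    intro c hc
    have := (hf.divisor hp1).mem c hc
    exact this
  -- the labels are normalised and lie in `H_p`
  have hlab : ∀ c ∈ S, IsPFraction p (|D c| / c) ∧ 0 < |D c| / c ∧ |D c| / c ≤ |D c| ∧
      |D c| < p * (|D c| / c) := by
    intro c hc
    obtain ⟨⟨hc1, hc2⟩, hne⟩ := hmem.1 hc
    have hc0 : 0 < c := zero_lt_one.trans_le hc1
    have habs : 0 < |D c| := abs_pos.2 hne
    refine ⟨?_, div_pos habs hc0, div_le_self habs.le hc1, ?_⟩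
    · by_cases h0 : 0 < D c
      · rw [abs_of_pos h0]; exact hDc c hc0
      · rw [abs_of_neg (lt_of_le_of_ne (not_lt.1 h0) hne), neg_div]; exact (hDc c hc0).neg
    · rw [← mul_div_assoc, lt_div_iff₀ hc0]
      nlinarith
  -- `deg (f) = 0` and `χ((f)) = 0` over the support
  have hdeg : ∑ c ∈ S, D c = 0 := by
    rw [hSdef, IsCpRational.divSupport, ← finsum_mem_eq_sum D (hf.finsum_cpOrder_eq_zero hp1).1]
    exact (hf.finsum_cpOrder_eq_zero hp1).2
  have hchi : pFractionChi p (∑ c ∈ S, D c / c) = 0 := by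
    rw [pFractionChi_sum hp0 S _ fun c hc => hDc c (zero_lt_one.trans_le (hmem.1 hc).1.1),
      ← finsum_mem_eq_sum_of_subset (s := Ico 1 (p : ℝ)) (fun c => pFractionChi p (D c / c)) ?_ ?_]
    · exact (hf.finsum_chi_cpOrder_eq_zero hp1).2
    · intro c hc
      rw [Finset.mem_coe, hmem]
      refine ⟨⟨hc.1.1, hc.1.2⟩, fun h0 => hc.2 ?_⟩
      simp only [h0, zero_div, pFractionChi_zero hp0]
    · intro c hc
      rw [Finset.mem_coe, hmem] at hc
      exact ⟨hc.1.1, hc.1.2⟩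
  have hσ : IsPFraction p (∑ c ∈ S, D c / c) :=
    IsPFraction.sum hp0.ne' S _ fun c hc => hDc c (zero_lt_one.trans_le (hmem.1 hc).1.1)
  have ha : IsPFraction p ((∑ c ∈ S, D c / c) / ((p : ℝ) - 1)) :=
    hσ.div_pred_of_chi_eq_zero hp1 hchi
  -- hypotheses of the engine
  have hlE : ∀ c ∈ S, 0 < |D c| / c ∧ |D c| / c ≤ |D c| ∧ |D c| < p * (|D c| / c) :=
    fun c hc => (hlab c hc).2
  have hHE : ∀ c ∈ S, IsPFraction p (|D c| / c) := fun c hc => (hlab c hc).1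
  have hdegE : ∑ c ∈ S, (w c : ℝ) * |D c| = 0 := by
    rw [Finset.sum_congr rfl hwμ, hdeg]
  have hrelE : ((p : ℝ) - 1) * ((∑ c ∈ S, D c / c) / ((p : ℝ) - 1)) =
      ∑ c ∈ S, (w c : ℝ) * (|D c| / c) := by
    rw [Finset.sum_congr rfl hwh, mul_div_cancel₀ _ (by linarith : ((p : ℝ) - 1) ≠ 0)]
  -- splitting `S` by the sign of the order
  have hsplit : ∀ g : ℝ → ℝ, ∑ c ∈ S, (w c : ℝ) * g c =
      (∑ c ∈ S.filter (fun c => 0 < D c), g c) - ∑ c ∈ S.filter (fun c => D c < 0), g c := by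
    intro g
    rw [← Finset.sum_filter_add_sum_filter_not S (fun c => 0 < D c)]
    have e1 : ∑ c ∈ S.filter (fun c => 0 < D c), (w c : ℝ) * g c =
        ∑ c ∈ S.filter (fun c => 0 < D c), g c :=
      Finset.sum_congr rfl fun c hc => by
        rw [Finset.mem_filter] at hc
        simp only [hw, if_pos hc.2, Int.cast_one, one_mul]
    have e2 : ∑ c ∈ S.filter (fun c => ¬ 0 < D c), (w c : ℝ) * g c =
        -∑ c ∈ S.filter (fun c => D c < 0), g c := by
      rw [Finset.filter_congr (p := fun c => ¬ 0 < D c) (q := fun c => D c < 0) fun c hc =>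
        ⟨fun h0 => lt_of_le_of_ne (not_lt.1 h0) (hmem.1 hc).2, fun h0 => not_lt.2 h0.le⟩,
        ← Finset.sum_neg_distrib]
      refine Finset.sum_congr rfl fun c hc => ?_
      rw [Finset.mem_filter] at hc
      simp only [hw, if_neg (not_lt.2 hc.2.le), Int.cast_neg, Int.cast_one, neg_one_mul]
    rw [e1, e2, ← sub_eq_add_neg]
  refine ⟨hlab, ha, by rw [hrelE, hsplit], ?_⟩
  -- the theta combination with the divisor of `f`
  have hF := thetaComb_isCpRational hp1 hlE hHE ha hdegE hrelE
  have hDper : ∀ t, 0 < t → D (p * t) = D t := (hf.divisor hp1).periodic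
  have hordF : ∀ x, 0 < x → cpOrder f x =
      cpOrder (thetaComb p S w (fun c => |D c| / c) (fun c => |D c|)
        ((∑ c ∈ S, D c / c) / ((p : ℝ) - 1))) x := by
    intro x hx
    rw [cpOrder_thetaComb hp1 hlE hHE ha hdegE hrelE hx]
    -- both sides are class functions: reduce to the representative `y ∈ [1, p)`
    obtain ⟨hy1, hy2, hxy⟩ := fundRed_spec hp1 one_pos hx
    set y := fundRed p 1 x with hydef
    have hy : 0 < y := zero_lt_one.trans_le hy1
    rw [mul_one] at hy2
    rw [show cpOrder f x = D y by
        rw [hxy]; exact periodic_zpow hp0 hDper _ _ hy,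
      show thetaCombDiv p S w (fun c => |D c| / c) (fun c => |D c|) x =
          thetaCombDiv p S w (fun c => |D c| / c) (fun c => |D c|) y by
        rw [hxy]; exact periodic_zpow hp0 (fun t _ => thetaCombDiv_mul_p hp1 S w _ _ t) _ _ hy,
      thetaCombDiv_of_mem hp1 w hlE hy1 hy2]
    have e : ∀ c ∈ S, (if y = |D c| / (|D c| / c) then (w c : ℝ) * |D c| else 0) =
        if y = c then D c else 0 := by
      intro c hc
      rw [div_div_cancel₀ (abs_pos.2 (hmem.1 hc).2).ne', hwμ c hc]
    rw [Finset.sum_congr rfl e, Finset.sum_ite_eq]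
    by_cases hyS : y ∈ S
    · rw [if_pos hyS]
    · rw [if_neg hyS]
      by_contra hne
      exact hyS (hmem.2 ⟨⟨hy1, hy2⟩, hne⟩)
  obtain ⟨κ, hκ⟩ := hf.exists_eq_add_const_of_cpOrder_eq hp1 hF hordF
  refine ⟨κ, fun x hx => ?_⟩
  rw [hκ x hx]
  unfold thetaComb
  rw [hsplit]

/-- **Theorem 5.12, printed (existential) form**: every `f ∈ 𝒦(C_p)` is
`Σ_i Θ_{h_i,μ_i} - Σ_j Θ_{h'_j,μ'_j} - hλ + c` with `c ∈ ℝ`, `h, h_i, h'_j ∈ H_p`,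
`(p-1)h = Σ h_i - Σ h'_j`, `h_i ≤ μ_i < ph_i`, `h'_j ≤ μ'_j < ph'_j` (both families indexed by finite
sets of points of the fundamental domain, labels as functions of the point).
[cite: ConnesConsani2017ScalingSite, Thm. 5.12] -/
theorem ConnesConsani2017_thm_5_12' (hp : p.Prime) (hf : IsCpRational p f) :
    ∃ (S₁ S₂ : Finset ℝ) (h μ : ℝ → ℝ) (a c : ℝ),
      (∀ i ∈ S₁ ∪ S₂, IsPFraction p (h i) ∧ 0 < h i ∧ h i ≤ μ i ∧ μ i < p * h i) ∧
      IsPFraction p a ∧ ((p : ℝ) - 1) * a = (∑ i ∈ S₁, h i) - ∑ j ∈ S₂, h j ∧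
      ∀ x, 0 < x → f x = (∑ i ∈ S₁, cpThetaHM p (h i) (μ i) x) -
        (∑ j ∈ S₂, cpThetaHM p (h j) (μ j) x) - a * x + c := by
  classical
  obtain ⟨hlab, ha, hrel, c, hc⟩ := ConnesConsani2017_thm_5_12 hp hf
  refine ⟨(hf.divSupport hp.one_lt).filter (fun c => 0 < cpOrder f c),
    (hf.divSupport hp.one_lt).filter (fun c => cpOrder f c < 0), fun c => |cpOrder f c| / c,
    fun c => |cpOrder f c|, _, c, fun i hi => ?_, ha, hrel, hc⟩
  rw [Finset.mem_union, Finset.mem_filter, Finset.mem_filter] at hi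
  rcases hi with hi | hi
  · exact hlab i hi.1
  · exact hlab i hi.1

end Thm512


/-! ## Prop. 5.11 for arbitrary labels `(h, μ) ∈ H_p⁺ × ℝ₊*` (the printed generality) — appended 2026-08-19 (cc-1 gen 4)

"Since `δ(ph, μ) = δ(h, μ)` we can choose the `h_i` and `h'_j` in such a way that `μh⁻¹ ∈ [1, p)`
for all of them" (proof of Theorem 5.12): every label is brought to a normalised one by a power of
`p` (`normSlope`), at the cost of an affine function, by iterating "`Θ_{ph,μ} = Θ_{h,μ} + hλ - μ`"
(`cpThetaHM_pow_mul`, `cpThetaHM_eq_normSlope`); the divisor `δ(h, μ)` is unchanged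
(`thetaDelta_normSlope`). This removes the normalisation hypothesis from
`ConnesConsani2017_prop_5_11` (`ConnesConsani2017_prop_5_11_general`). -/

section GeneralLabels

variable {p : ℕ} {ι κ : Type*}

/-- `𝒦(C_p)` membership only depends on the values on `(0, ∞)` (`p > 1`).
[cite: ConnesConsani2017ScalingSite, Prop. 5.2 (i) (functions on ℝ₊*)] -/
theorem IsCpRational.congr (hp : 1 < p) {f g : ℝ → ℝ} (hg : IsCpRational p g)
    (hfg : ∀ x, 0 < x → f x = g x) : IsCpRational p f := by
  have hpR : (0 : ℝ) < p := by exact_mod_cast zero_lt_one.trans hp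
  obtain ⟨hper, n, lam, h, h0, hmono, hlast, hmem, hpiece⟩ := hg
  refine ⟨fun x hx => by rw [hfg x hx, hfg _ (by positivity), hper x hx], n, lam, h, h0, hmono,
    hlast, hmem, fun j x hx1 hx2 => ?_⟩
  have hj : 0 < lam j.castSucc := h0.trans_le (hmono.monotone (Fin.zero_le _))
  rw [hfg x (hj.trans_le hx1), hfg _ hj]
  exact hpiece j x hx1 hx2

/-- The order at `λ > 0` only depends on the values on `(0, ∞)`.
[cite: ConnesConsani2017ScalingSite, Def. 4.6] -/
theorem cpOrder_congr {f g : ℝ → ℝ} {x : ℝ} (hx : 0 < x) (hfg : ∀ y, 0 < y → f y = g y) :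
    cpOrder f x = cpOrder g x := by
  have hev : f =ᶠ[𝓝 x] g :=
    Filter.eventually_of_mem (Ioi_mem_nhds hx) fun y hy => hfg y hy
  unfold cpOrder
  rw [(hev.filter_mono nhdsWithin_le_nhds).derivWithin_eq (hfg x hx),
    (hev.filter_mono nhdsWithin_le_nhds).derivWithin_eq (hfg x hx)]

/-- Iterating "`Θ_{ph,μ}(λ) = Θ_{h,μ}(λ) + hλ - μ`":
`Θ_{pⁿh,μ}(λ) = Θ_{h,μ}(λ) + (Σ_{m<n} p^m) hλ - nμ`. [cite: ConnesConsani2017ScalingSite, §5.3 (second displayed equation after the definition of Θ_{h,μ})] -/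
theorem cpThetaHM_pow_mul (hp : 1 < p) {h μ x : ℝ} (hh : 0 < h) (hμ : 0 < μ) (hx : 0 < x)
    (n : ℕ) :
    cpThetaHM p ((p : ℝ) ^ n * h) μ x =
      cpThetaHM p h μ x + (∑ m ∈ Finset.range n, (p : ℝ) ^ m) * h * x - n * μ := by
  have hpR : (0 : ℝ) < p := by exact_mod_cast zero_lt_one.trans hp
  induction n with
  | zero => simp
  | succ n ih =>
    have hpn : 0 < (p : ℝ) ^ n * h := by positivity
    rw [pow_succ, mul_comm ((p : ℝ) ^ n) (p : ℝ), mul_assoc, cpThetaHM_pmul hp hpn hμ hx, ih,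
      Finset.sum_range_succ]
    push_cast
    ring

/-- **The normalised slope** `h̃ := μ/c̃`, where `c̃ ∈ [1, p)` is the representative of `c = μ/h`
modulo `p^ℤ`; then `μh̃⁻¹ = c̃ ∈ [1, p)` and `h̃ = p^e h`, `e = ⌊log_p(μ/h)⌋`.
[cite: ConnesConsani2017ScalingSite, Thm. 5.12 (proof: "we can choose the h_i … in such a way that μh⁻¹ ∈ [1,p)")] -/
def normSlope (p : ℕ) (h μ : ℝ) : ℝ :=
  μ / fundRed p 1 (μ / h)

/-- `h̃ = p^e h` with `e = fundExp p 1 (μ/h)`. [cite: ConnesConsani2017ScalingSite, Thm. 5.12 (proof)] -/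
theorem normSlope_eq_zpow_mul (p : ℕ) {h μ : ℝ} (hμ : 0 < μ) :
    normSlope p h μ = (p : ℝ) ^ fundExp p 1 (μ / h) * h := by
  unfold normSlope fundRed
  rw [div_div_eq_mul_div, div_div_eq_mul_div, div_eq_iff hμ.ne']
  ring

/-- `μ / h̃ = c̃`, the representative of `μ/h` in `[1, p)`. [cite: ConnesConsani2017ScalingSite, Thm. 5.12 (proof)] -/
theorem div_normSlope (p : ℕ) {h μ : ℝ} (hμ : 0 < μ) :
    μ / normSlope p h μ = fundRed p 1 (μ / h) := by
  unfold normSlope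
  rw [div_div_cancel₀ hμ.ne']

/-- The normalised label is normalised: `h̃ ∈ H_p`, `0 < h̃ ≤ μ < ph̃`.
[cite: ConnesConsani2017ScalingSite, Thm. 5.12 (proof)] -/
theorem normSlope_spec (hp : 1 < p) {h μ : ℝ} (hhp : IsPFraction p h) (hh : 0 < h) (hμ : 0 < μ) :
    IsPFraction p (normSlope p h μ) ∧ 0 < normSlope p h μ ∧ normSlope p h μ ≤ μ ∧
      μ < p * normSlope p h μ := by
  have hpR : (0 : ℝ) < p := by exact_mod_cast zero_lt_one.trans hp
  obtain ⟨h1, h2, -⟩ := fundRed_spec hp one_pos (div_pos hμ hh)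
  rw [mul_one] at h2
  have hpos : 0 < normSlope p h μ := by
    rw [normSlope_eq_zpow_mul p hμ]; exact mul_pos (zpow_pos hpR _) hh
  refine ⟨by rw [normSlope_eq_zpow_mul p hμ]; exact hhp.mul_zpow _, hpos, ?_, ?_⟩
  · rw [← div_normSlope p hμ, le_div_iff₀ hpos, one_mul] at h1
    exact h1
  · rw [← div_normSlope p hμ, div_lt_iff₀ hpos] at h2
    linarith

/-- The affine correction slope `(h̃ - h)/(p - 1)` lies in `H_p`: it is `(Σ_{m<e} p^m) h` for `e ≥ 0`
and `-(Σ_{m<-e} p^m) h̃` for `e < 0`. [cite: ConnesConsani2017ScalingSite, Thm. 5.12 (proof) with §5.3] -/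
theorem isPFraction_normSlope_sub_div (hp : 1 < p) {h μ : ℝ} (hhp : IsPFraction p h)
    (hμ : 0 < μ) : IsPFraction p ((normSlope p h μ - h) / ((p : ℝ) - 1)) := by
  have hpR : (0 : ℝ) < p := by exact_mod_cast zero_lt_one.trans hp
  have hp1 : ((p : ℝ) - 1) ≠ 0 := by
    have : (1 : ℝ) < p := by exact_mod_cast hp
    linarith
  have hG : ∀ n : ℕ, (∑ m ∈ Finset.range n, (p : ℝ) ^ m) * ((p : ℝ) - 1) = (p : ℝ) ^ n - 1 :=
    fun n => geom_sum_mul _ _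
  have hGnat : ∀ n : ℕ, (∑ m ∈ Finset.range n, (p : ℝ) ^ m) =
      ((∑ m ∈ Finset.range n, p ^ m : ℕ) : ℤ) := fun n => by push_cast; rfl
  rw [normSlope_eq_zpow_mul p hμ]
  obtain ⟨n, hn | hn⟩ := (fundExp p 1 (μ / h)).eq_nat_or_neg
  · rw [hn, zpow_natCast]
    have e : ((p : ℝ) ^ n * h - h) / ((p : ℝ) - 1) = (∑ m ∈ Finset.range n, (p : ℝ) ^ m) * h := by
      rw [div_eq_iff hp1]
      linear_combination (-h) * hG n
    rw [e, hGnat]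
    exact hhp.int_mul _
  · rw [hn]
    have hht : IsPFraction p ((p : ℝ) ^ (-(n : ℤ)) * h) := hhp.mul_zpow _
    have e : ((p : ℝ) ^ (-(n : ℤ)) * h - h) / ((p : ℝ) - 1) =
        (-((∑ m ∈ Finset.range n, p ^ m : ℕ) : ℤ) : ℤ) * ((p : ℝ) ^ (-(n : ℤ)) * h) := by
      rw [div_eq_iff hp1]
      push_cast
      have hz : (p : ℝ) ^ (-(n : ℤ)) * (p : ℝ) ^ n = 1 := by
        rw [zpow_neg, zpow_natCast, inv_mul_cancel₀ (pow_ne_zero _ hpR.ne')]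
      linear_combination ((p : ℝ) ^ (-(n : ℤ)) * h) * hG n + h * hz
    rw [e]
    exact hht.int_mul _

/-- **Reduction to a normalised label**: `Θ_{h,μ}(λ) = Θ_{h̃,μ}(λ) - ((h̃ - h)/(p-1))λ + eμ` for `λ > 0`,
`e = fundExp p 1 (μ/h)` (iterate of "`Θ_{ph,μ} = Θ_{h,μ} + hλ - μ`").
[cite: ConnesConsani2017ScalingSite, Thm. 5.12 (proof) with §5.3] -/
theorem cpThetaHM_eq_normSlope (hp : 1 < p) {h μ x : ℝ} (hh : 0 < h) (hμ : 0 < μ) (hx : 0 < x) :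
    cpThetaHM p h μ x = cpThetaHM p (normSlope p h μ) μ x -
      (normSlope p h μ - h) / ((p : ℝ) - 1) * x + (fundExp p 1 (μ / h) : ℝ) * μ := by
  have hpR : (0 : ℝ) < p := by exact_mod_cast zero_lt_one.trans hp
  have hp1 : ((p : ℝ) - 1) ≠ 0 := by
    have : (1 : ℝ) < p := by exact_mod_cast hp
    linarith
  have hG : ∀ n : ℕ, (∑ m ∈ Finset.range n, (p : ℝ) ^ m) * ((p : ℝ) - 1) = (p : ℝ) ^ n - 1 :=
    fun n => geom_sum_mul _ _
  rw [normSlope_eq_zpow_mul p hμ]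
  obtain ⟨n, hn | hn⟩ := (fundExp p 1 (μ / h)).eq_nat_or_neg
  · rw [hn, zpow_natCast, cpThetaHM_pow_mul hp hh hμ hx n]
    have e : ((p : ℝ) ^ n * h - h) / ((p : ℝ) - 1) = (∑ m ∈ Finset.range n, (p : ℝ) ^ m) * h := by
      rw [div_eq_iff hp1]
      linear_combination (-h) * hG n
    rw [e]
    push_cast
    ring
  · rw [hn]
    set ht := (p : ℝ) ^ (-(n : ℤ)) * h with hht
    have htpos : 0 < ht := mul_pos (zpow_pos hpR _) hh
    have hback : (p : ℝ) ^ n * ht = h := by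
      rw [hht, ← mul_assoc, ← zpow_natCast, ← zpow_add₀ hpR.ne', add_neg_cancel, zpow_zero,
        one_mul]
    have key := cpThetaHM_pow_mul hp htpos hμ hx n
    rw [hback] at key
    have e : (ht - h) / ((p : ℝ) - 1) = -((∑ m ∈ Finset.range n, (p : ℝ) ^ m) * ht) := by
      rw [div_eq_iff hp1, ← hback]
      linear_combination ht * hG n
    rw [key, e]
    push_cast
    ring

/-- Classes modulo `p^ℤ` are invariant under `c ↦ p^k c`. [cite: ConnesConsani2017ScalingSite, Lemma 5.1 (i)] -/
theorem inClass_zpow_mul_iff (hp : 1 < p) (c x : ℝ) (k : ℤ) :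
    InClass p ((p : ℝ) ^ k * c) x ↔ InClass p c x := by
  have hp0 : (p : ℝ) ≠ 0 := by exact_mod_cast (zero_lt_one.trans hp).ne'
  constructor
  · rintro ⟨m, hm⟩
    exact ⟨m + k, by rw [hm, zpow_add₀ hp0]; ring⟩
  · rintro ⟨m, hm⟩
    exact ⟨m - k, by rw [hm, zpow_sub₀ hp0]; field_simp⟩

/-- **`δ(h, μ) = δ(h̃, μ)`**: normalising the label does not change the divisor ("`δ(ph,μ) = δ(h,μ)`"
iterated). [cite: ConnesConsani2017ScalingSite, §5.3 ("δ(h,μ) only depends upon the class of h modulo the multiplication by powers of p")] -/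
theorem thetaDelta_normSlope (hp : 1 < p) {h μ : ℝ} (hh : 0 < h) (hμ : 0 < μ) (x : ℝ) :
    thetaDelta p (normSlope p h μ) μ x = thetaDelta p h μ x := by
  classical
  have key : InClass p (μ / normSlope p h μ) x ↔ InClass p (μ / h) x := by
    rw [div_normSlope p hμ]
    obtain ⟨-, -, h3⟩ := fundRed_spec hp one_pos (div_pos hμ hh)
    conv_rhs => rw [h3]
    exact (inClass_zpow_mul_iff hp _ _ _).symm
  rw [thetaDelta_apply, thetaDelta_apply]
  by_cases hc : InClass p (μ / normSlope p h μ) x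
  · rw [if_pos hc, if_pos (key.1 hc)]
  · rw [if_neg hc, if_neg (fun h' => hc (key.2 h'))]

/-- **Connes–Consani 2017, Proposition 5.11 (as printed, arbitrary labels `(h_i, μ_i), (h'_j, μ'_j) ∈
H_p⁺ × ℝ₊*`)**: if `Σ μ_i = Σ μ'_j` (`deg D = 0`) and `h ∈ H_p` fulfills `(p-1)h = Σ h_i - Σ h'_j`,
then `f(λ) := Σ_i Θ_{h_i,μ_i}(λ) - Σ_j Θ_{h'_j,μ'_j}(λ) - hλ` belongs to `𝒦(C_p)` (continuous,
piecewise affine with slopes in `H_p`, `f(pλ) = f(λ)`) and `div(f) = Σ_i δ(h_i,μ_i) - Σ_j δ(h'_j,μ'_j)`.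
Reduced to the normalised case by `cpThetaHM_eq_normSlope` / `thetaDelta_normSlope`, exactly as in
the printed proof of Theorem 5.12. [cite: ConnesConsani2017ScalingSite, Prop. 5.11] -/
theorem ConnesConsani2017_prop_5_11_general (hp : p.Prime) (s : Finset ι) (t : Finset κ)
    (h μ : ι → ℝ) (h' μ' : κ → ℝ) (a : ℝ)
    (hl : ∀ i ∈ s, IsPFraction p (h i) ∧ 0 < h i ∧ 0 < μ i)
    (hl' : ∀ j ∈ t, IsPFraction p (h' j) ∧ 0 < h' j ∧ 0 < μ' j)
    (ha : IsPFraction p a) (hdeg : ∑ i ∈ s, μ i = ∑ j ∈ t, μ' j)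
    (hrel : ((p : ℝ) - 1) * a = ∑ i ∈ s, h i - ∑ j ∈ t, h' j) :
    IsCpRational p (fun x => (∑ i ∈ s, cpThetaHM p (h i) (μ i) x) -
        (∑ j ∈ t, cpThetaHM p (h' j) (μ' j) x) - a * x) ∧
      ∀ x, 0 < x →
        cpOrder (fun x => (∑ i ∈ s, cpThetaHM p (h i) (μ i) x) -
            (∑ j ∈ t, cpThetaHM p (h' j) (μ' j) x) - a * x) x =
          (∑ i ∈ s, thetaDelta p (h i) (μ i) x) - ∑ j ∈ t, thetaDelta p (h' j) (μ' j) x := by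
  have hp1 := hp.one_lt
  have hp0 := hp.pos
  have hpm1 : ((p : ℝ) - 1) ≠ 0 := by
    have : (1 : ℝ) < p := by exact_mod_cast hp1
    linarith
  -- normalised labels, corrected slope and the constant
  set H : ι → ℝ := fun i => normSlope p (h i) (μ i) with hH
  set H' : κ → ℝ := fun j => normSlope p (h' j) (μ' j) with hH'
  set A : ι → ℝ := fun i => (H i - h i) / ((p : ℝ) - 1) with hA
  set A' : κ → ℝ := fun j => (H' j - h' j) / ((p : ℝ) - 1) with hA'
  set b : ℝ := a + (∑ i ∈ s, A i) - ∑ j ∈ t, A' j with hb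
  set K : ℝ := (∑ i ∈ s, (fundExp p 1 (μ i / h i) : ℝ) * μ i) -
    ∑ j ∈ t, (fundExp p 1 (μ' j / h' j) : ℝ) * μ' j with hK
  set F : ℝ → ℝ := fun x => (∑ i ∈ s, cpThetaHM p (H i) (μ i) x) -
    (∑ j ∈ t, cpThetaHM p (H' j) (μ' j) x) - b * x with hF
  -- `f = F + K` on `(0, ∞)`
  have hfun : ∀ x, 0 < x → (∑ i ∈ s, cpThetaHM p (h i) (μ i) x) -
      (∑ j ∈ t, cpThetaHM p (h' j) (μ' j) x) - a * x = F x + K := by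
    intro x hx
    rw [Finset.sum_congr rfl fun i hi =>
        cpThetaHM_eq_normSlope hp1 (hl i hi).2.1 (hl i hi).2.2 hx,
      Finset.sum_congr rfl fun j hj =>
        cpThetaHM_eq_normSlope hp1 (hl' j hj).2.1 (hl' j hj).2.2 hx]
    simp only [hF, hb, hK, hA, hA', hH, hH', Finset.sum_add_distrib, Finset.sum_sub_distrib,
      ← Finset.sum_mul]
    ring
  -- hypotheses of the normalised proposition
  have hL : ∀ i ∈ s, IsPFraction p (H i) ∧ 0 < H i ∧ H i ≤ μ i ∧ μ i < p * H i :=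
    fun i hi => normSlope_spec hp1 (hl i hi).1 (hl i hi).2.1 (hl i hi).2.2
  have hL' : ∀ j ∈ t, IsPFraction p (H' j) ∧ 0 < H' j ∧ H' j ≤ μ' j ∧ μ' j < p * H' j :=
    fun j hj => normSlope_spec hp1 (hl' j hj).1 (hl' j hj).2.1 (hl' j hj).2.2
  have hbp : IsPFraction p b := by
    refine (ha.add hp0.ne' (IsPFraction.sum hp0.ne' s A fun i hi => ?_)).sub hp0.ne'
      (IsPFraction.sum hp0.ne' t A' fun j hj => ?_)
    · exact isPFraction_normSlope_sub_div hp1 (hl i hi).1 (hl i hi).2.2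
    · exact isPFraction_normSlope_sub_div hp1 (hl' j hj).1 (hl' j hj).2.2
  have hrelb : ((p : ℝ) - 1) * b = ∑ i ∈ s, H i - ∑ j ∈ t, H' j := by
    have e1 : ((p : ℝ) - 1) * ∑ i ∈ s, A i = ∑ i ∈ s, (H i - h i) := by
      rw [Finset.mul_sum]
      exact Finset.sum_congr rfl fun i _ => by rw [hA]; exact mul_div_cancel₀ _ hpm1
    have e2 : ((p : ℝ) - 1) * ∑ j ∈ t, A' j = ∑ j ∈ t, (H' j - h' j) := by
      rw [Finset.mul_sum]
      exact Finset.sum_congr rfl fun j _ => by rw [hA']; exact mul_div_cancel₀ _ hpm1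
    rw [hb, mul_sub, mul_add, hrel, e1, e2, Finset.sum_sub_distrib, Finset.sum_sub_distrib]
    ring
  obtain ⟨hFrat, hFord⟩ := ConnesConsani2017_prop_5_11 hp s t H μ H' μ' b hL hL' hbp hdeg hrelb
  have hFK : IsCpRational p (fun x => F x + K) := hFrat.add hp1 (isCpRational_const hp1 K)
  refine ⟨hFK.congr hp1 fun x hx => hfun x hx, fun x hx => ?_⟩
  rw [cpOrder_congr hx fun y hy => hfun y hy,
    cpOrder_add_of_hasDerivWithinAt (f := F) (g := fun _ => K)
      (hFrat.hasDerivWithinAt_Ioi hp1 hx).1 (hFrat.hasDerivWithinAt_Iio hp1 hx).1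
      (hasDerivWithinAt_const x (Ioi x) K) (hasDerivWithinAt_const x (Iio x) K),
    cpOrder_const, add_zero, hFord x hx]
  rw [Finset.sum_congr rfl fun i hi => thetaDelta_normSlope hp1 (hl i hi).2.1 (hl i hi).2.2 x,
    Finset.sum_congr rfl fun j hj => thetaDelta_normSlope hp1 (hl' j hj).2.1 (hl' j hj).2.2 x]

end GeneralLabels

end Literature.NumberTheory.ConnesConsani
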